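import Mathlib.Algebra.Field.ZMod
import Mathlib.Data.ZMod.Units
import Mathlib.Data.Fintype.BigOperators
import Mathlib.Algebra.BigOperators.Ring.Finset
import Mathlib.LinearAlgebra.Dual.Lemmas
import Mathlib.Analysis.SpecialFunctions.Pow.Real
import Mathlib.Analysis.SpecialFunctions.Exponential
import Mathlib.Analysis.Complex.ExponentialBounds
import Mathlib.Algebra.Order.Field.GeomSum
import Mathlib.Data.Nat.Choose.Bounds
import Literature.Computability.MetaComplexity.FpLinearSystems
import HarnessLib

/-!
# Discharge of `fpExpandingSystem`: expanding unsatisfiable linear systems mod `p` exist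
(Beck–Impagliazzo 2013, Lemma 4.2; Beck 2017, Lemma 5.2; Bonacina 2017, Prop. 8.1)

Sibling proof file of `FpLinearSystems.lean` (D-0014). It proves
`Literature.CplxMeta.fpExpandingSystem_holds : fpExpandingSystem` — for every prime `p ≥ 10⁴` there are
`δ = 1/p` and `θ = (2 + 15 log p)/p` (so `C = 17`, `c = 1` in the fact) such that for all
`n ≥ max(100, 3p)` some system of `n+1` equations mod `p` in `n` variables has supports of size
`≤ p²`, is unsatisfiable with all sub-systems of `≤ 3δn` equations satisfiable, and has every
combination with `δn ≤ |supp v| ≤ 3δn` non-zero coefficients supported on `≥ (1-θ)n` variables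
— together with the linear-algebra lemma `exists_dual_witness` (Fredholm alternative over a
field) used here and by `StrongResolutionWidthProofs.lean`.

The printed source (Beck 2017, Lemma 5.2, pp. 124–125 = Beck–Impagliazzo 2013, Lemma 4.2,
quoted as Bonacina 2017, Prop. 8.1) gives a probabilistic sketch (random sparse rows, union
bounds; the small-set part is only indicated). The proof below is a complete finite COUNT over an
explicit uniform sample space, with its own (generous) constants; it follows the architecture of
the sketch.

## Proof architecture

1. **Model** (`PickSpace m d n p`): row `i` is the sum of `d` independent uniform *picks*
   `(column, non-zero value)` (sampling with replacement, so supports have size `≤ d`;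
   `rowVec`, `combVec`, `hits`, `covered`). A column hit by exactly one pick of the rows of
   `supp v` gives a non-zero coordinate of `Σ v_i row_i` (`combVec_ne_zero_of_card_hits_eq_one`),
   and if all covered columns are hit twice then at most `|S|d/2` columns are covered
   (`two_mul_card_covered_le`).
2. **Exact counts.** Confined picks: the samples whose picks of the rows of `S` all land in `U`
   number `|Ω| (|U|/n)^{|S|d}` (`card_confined_mul`, a product of coordinate fibres). Vanishing
   covered columns: the samples in which `T ⊆ covered` and `Σ v_i row_i` vanishes on `T` are at
   most `|Ω| (p-1)^{-|T|}` (`card_zeros_mul_le`: split a sample into columns and values;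
   designate one pick per column of `T`; off the designated values the vanishing value
   assignments inject, `card_vals_zero_le`).
3. **Union bounds** (`card_cover_le`, `card_zeros_exists_le`) and the per-vector bounds for the
   three events: vanishing combination with small support (`card_kernel_small_le`, unique
   neighbours), with large support (`card_kernel_large_le`), and expansion failure
   (`card_expansion_fail_le`).
4. **Estimates**: `C(n,k) ≤ (en/k)^k` (`choose_le_epow`), `(1-x)^k ≤ e^{-xk}`,
   `#{v : |supp v| = s} ≤ C(m,s)(p-1)^s` (`card_vsupp_card_eq_le`), `log p ≤ p/480` and
   `9 ≤ log p` for `p ≥ 10⁴`.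
5. **Three regimes** with `d = 2d'`, `d' = ⌊(p²-1)/2⌋`: supports `s ≤ n/(8d')` contribute
   `≤ |Ω|/7` (`regime1_bound`, a geometric series with ratio `≤ 1/8`), supports
   `n/(8d') < s ≤ 3n/p` contribute `≤ |Ω|/8` to the vanishing events (`regime2_bound`), and the
   expansion failures over `n/p ≤ s ≤ 3n/p` contribute `≤ |Ω|/8` (`regime3_bound`); hence a good
   sample exists (`exists_goodSample`).
6. **The system**: rows of a good sample, right-hand side outside the image of the coefficient
   matrix (`|𝔽_p^n| < |𝔽_p^{n+1}|`); an unsatisfiable small sub-system would have a dual witness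
   (`exists_dual_witness`), i.e. a short vanishing combination — excluded (`fpExpandingSystem_holds`).

## References

* C. Beck, *Time and Space in Proof Complexity*, PhD thesis, Princeton 2017, §5.3, Def. 5.1,
  Lemma 5.2 (and its proof sketch), Claim 5.5.
* C. Beck, R. Impagliazzo, *Strong ETH holds for regular resolution*, STOC 2013, Lemma 4.2.
* I. Bonacina, *Space in Weak Propositional Proof Systems*, Springer 2017, Prop. 8.1.
-/

namespace Literature.Computability.MetaComplexity

open Finset

/-- **Unsolvable linear systems have a dual witness** (the Fredholm alternative over a
field, Bonacina 2017 §8.3: "`S'↾σ'` unsatisfiable means exactly that there exists some `v` …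
such that `Σ v_i E_i↾σ'` is unsatisfiable"): if `A z = b` has no solution then some
combination `λ` of the equations has all coefficients `Σ_k λ_k A_{k,i}` zero and right-hand
side `Σ_k λ_k b_k ≠ 0`. [cite: Bonacina2017, §8.3 (eq. (8.43), linear algebra)] -/
theorem exists_dual_witness {K : Type*} [Field K] {ι κ : Type*} [Fintype ι] [DecidableEq ι]
    [Fintype κ] [DecidableEq κ] (A : κ → ι → K) (b : κ → K)
    (h : ¬ ∃ z : ι → K, ∀ k, ∑ i, A k i * z i = b k) :
    ∃ lam : κ → K, (∀ i, ∑ k, lam k * A k i = 0) ∧ ∑ k, lam k * b k ≠ 0 := by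
  let L : (ι → K) →ₗ[K] (κ → K) :=
    { toFun := fun z k => ∑ i, A k i * z i
      map_add' := fun x y => by
        funext k; simp only [Pi.add_apply, mul_add, Finset.sum_add_distrib]
      map_smul' := fun r x => by
        funext k; simp only [Pi.smul_apply, smul_eq_mul, RingHom.id_apply, Finset.mul_sum]
        exact Finset.sum_congr rfl fun i _ => by ring }
  have hb : b ∉ LinearMap.range L := by
    rintro ⟨z, hz⟩
    exact h ⟨z, fun k => by simpa [L] using congrFun hz k⟩
  obtain ⟨f, hfb, hf⟩ := Submodule.exists_dual_map_eq_bot_of_notMem hb inferInstance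
  let lam : κ → K := fun k => f fun j => if k = j then 1 else 0
  have hfx : ∀ x : κ → K, f x = ∑ k, lam k * x k := fun x => by
    rw [LinearMap.pi_apply_eq_sum_univ f x]
    exact Finset.sum_congr rfl fun k _ => by simp [lam, mul_comm]
  refine ⟨lam, fun i => ?_, ?_⟩
  · have hmem : (L fun j => if j = i then 1 else 0) ∈ LinearMap.range L := LinearMap.mem_range_self L _
    have hzero : f (L fun j => if j = i then 1 else 0) = 0 := by
      have : f (L fun j => if j = i then 1 else 0) ∈ Submodule.map f (LinearMap.range L) :=
        Submodule.mem_map_of_mem hmem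
      rw [hf] at this
      exact (Submodule.mem_bot K).1 this
    rw [hfx] at hzero
    rw [← hzero]
    refine Finset.sum_congr rfl fun k _ => ?_
    simp [L, Finset.sum_ite_eq', mul_comm]
  · rw [hfx] at hfb
    simpa [mul_comm] using hfb

end Literature.Computability.MetaComplexity

namespace Literature.Computability.MetaComplexity

open Finset

/-- A *pick*: a column together with a non-zero value. A row of the random matrix is the sum
of `d` independent uniform picks (Beck 2017, proof of Lemma 5.2, with replacement: supports
of size `≤ d`). [Beck 2017, Lemma 5.2 (proof)] [folklore] -/
abbrev Pick (n p : ℕ) : Type := Fin n × (ZMod p)ˣ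

/-- The sample space: `d` picks for each of the `m` rows. [Beck 2017, Lemma 5.2 (proof)]
[folklore] -/
abbrev PickSpace (m d n p : ℕ) : Type := Fin m × Fin d → Pick n p

section Model

variable {m d n p : ℕ}

/-- Row `i` of the matrix of a sample: `Σ_k val(i,k) · e_{col(i,k)}`. [Beck 2017, Lemma 5.2]
[folklore] -/
def rowVec (ω : PickSpace m d n p) (i : Fin m) (j : Fin n) : ZMod p :=
  ∑ k : Fin d, if (ω (i, k)).1 = j then ((ω (i, k)).2 : ZMod p) else 0

/-- Coordinate `j` of the combination `Σ_i v_i · row_i`. [Bonacina 2017, Prop. 8.1(3)]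
[folklore] -/
def combVec (ω : PickSpace m d n p) (v : Fin m → ZMod p) (j : Fin n) : ZMod p :=
  ∑ i, v i * rowVec ω i j

/-- The picks of the rows in `S` that hit column `j`. [folklore] -/
def hits (ω : PickSpace m d n p) (S : Finset (Fin m)) (j : Fin n) : Finset (Fin m × Fin d) :=
  univ.filter fun x => x.1 ∈ S ∧ (ω x).1 = j

/-- The columns covered by the picks of the rows in `S`. [Beck 2017, Lemma 5.2 (proof: "has
ones in at least … columns")] [folklore] -/
def covered (ω : PickSpace m d n p) (S : Finset (Fin m)) : Finset (Fin n) :=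
  univ.filter fun j => (hits ω S j).Nonempty

/-- Membership in `hits`. [folklore] -/
theorem mem_hits {ω : PickSpace m d n p} {S : Finset (Fin m)} {j : Fin n} {x : Fin m × Fin d} :
    x ∈ hits ω S j ↔ x.1 ∈ S ∧ (ω x).1 = j := by
  simp [hits]

/-- Membership in `covered`. [folklore] -/
theorem mem_covered {ω : PickSpace m d n p} {S : Finset (Fin m)} {j : Fin n} :
    j ∈ covered ω S ↔ ∃ x : Fin m × Fin d, x.1 ∈ S ∧ (ω x).1 = j := by
  simp only [covered, Finset.mem_filter, Finset.mem_univ, true_and, Finset.Nonempty, mem_hits]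

/-- The combination as one sum over all picks. [folklore] -/
theorem combVec_eq_sum (ω : PickSpace m d n p) (v : Fin m → ZMod p) (j : Fin n) :
    combVec ω v j = ∑ x : Fin m × Fin d, if (ω x).1 = j then v x.1 * ((ω x).2 : ZMod p) else 0 := by
  rw [combVec, Fintype.sum_prod_type]
  refine Finset.sum_congr rfl fun i _ => ?_
  rw [rowVec, Finset.mul_sum]
  refine Finset.sum_congr rfl fun k _ => ?_
  split_ifs <;> simp

/-- Only the picks of rows in the support of `v` that hit `j` contribute to coordinate `j`.
[folklore] -/
theorem combVec_eq_sum_hits (ω : PickSpace m d n p) (v : Fin m → ZMod p) (j : Fin n)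
    {S : Finset (Fin m)} (hS : ∀ i, v i ≠ 0 → i ∈ S) :
    combVec ω v j = ∑ x ∈ hits ω S j, v x.1 * ((ω x).2 : ZMod p) := by
  rw [combVec_eq_sum, ← Finset.sum_filter]
  symm
  refine Finset.sum_subset (fun x hx => ?_) fun x hx hx' => ?_
  · rw [Finset.mem_filter]; exact ⟨Finset.mem_univ _, (mem_hits.1 hx).2⟩
  · rw [Finset.mem_filter] at hx
    have hv : v x.1 = 0 := by
      by_contra hv
      exact hx' (mem_hits.2 ⟨hS _ hv, hx.2⟩)
    rw [hv, zero_mul]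

/-- **A column hit exactly once is non-zero**: if exactly one pick of the rows of the support
of `v` lands in column `j`, the combination has a non-zero `j`-th coordinate.
[Beck 2017, Lemma 5.2 (proof, unique neighbours)] [folklore] -/
theorem combVec_ne_zero_of_card_hits_eq_one [Fact p.Prime] {ω : PickSpace m d n p} {v : Fin m → ZMod p}
    {S : Finset (Fin m)} (hS : ∀ i, v i ≠ 0 ↔ i ∈ S) {j : Fin n} (h : (hits ω S j).card = 1) :
    combVec ω v j ≠ 0 := by
  obtain ⟨x, hx⟩ := Finset.card_eq_one.1 h
  rw [combVec_eq_sum_hits ω v j (fun i hi => (hS i).1 hi), hx, Finset.sum_singleton]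
  have hxS : x.1 ∈ S := (mem_hits.1 (hx ▸ Finset.mem_singleton_self x)).1
  exact mul_ne_zero ((hS _).2 hxS) (Units.ne_zero _)

/-- **Pigeonhole on picks**: the picks of the rows of `S` number `|S| d`; if every covered
column is hit at least twice, at most `|S| d / 2` columns are covered.
[Beck 2017, Lemma 5.2 (proof)] [folklore] -/
theorem two_mul_card_covered_le {ω : PickSpace m d n p} {S : Finset (Fin m)}
    (h : ∀ j ∈ covered ω S, 2 ≤ (hits ω S j).card) : 2 * (covered ω S).card ≤ S.card * d := by
  have hsum : ∑ j ∈ covered ω S, (hits ω S j).card = S.card * d := by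
    have hdisj : (↑(covered ω S) : Set (Fin n)).PairwiseDisjoint (hits ω S) := by
      intro j _ j' _ hne
      rw [Function.onFun, Finset.disjoint_left]
      intro x hx hx'
      exact hne ((mem_hits.1 hx).2.symm.trans (mem_hits.1 hx').2)
    rw [← Finset.card_biUnion hdisj]
    have : (covered ω S).biUnion (hits ω S) = univ.filter fun x : Fin m × Fin d => x.1 ∈ S := by
      ext x
      simp only [Finset.mem_biUnion, mem_covered, mem_hits, Finset.mem_filter, Finset.mem_univ, true_and]
      constructor
      · rintro ⟨j, -, hx, -⟩; exact hx
      · intro hx; exact ⟨(ω x).1, ⟨x, hx, rfl⟩, hx, rfl⟩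
    rw [this]
    have : (univ.filter fun x : Fin m × Fin d => x.1 ∈ S) = S ×ˢ (univ : Finset (Fin d)) := by
      ext x; simp
    rw [this, Finset.card_product, Finset.card_univ, Fintype.card_fin]
  calc 2 * (covered ω S).card = ∑ j ∈ covered ω S, 2 := by rw [Finset.sum_const, smul_eq_mul, mul_comm]
    _ ≤ ∑ j ∈ covered ω S, (hits ω S j).card := Finset.sum_le_sum h
    _ = S.card * d := hsum

/-- The support of the combination vector over the model is that of `lincomb`. [folklore] -/
theorem rowVec_supp_card_le (ω : PickSpace m d n p) (i : Fin m) :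
    (univ.filter fun j => rowVec ω i j ≠ 0).card ≤ d := by
  calc (univ.filter fun j => rowVec ω i j ≠ 0).card
      ≤ ((univ : Finset (Fin d)).image fun k => (ω (i, k)).1).card := Finset.card_le_card fun j hj => by
        rw [Finset.mem_filter] at hj
        rw [Finset.mem_image]
        by_contra hno
        push Not at hno
        apply hj.2
        rw [rowVec]
        exact Finset.sum_eq_zero fun k _ => if_neg (hno k (Finset.mem_univ k))
    _ ≤ (univ : Finset (Fin d)).card := Finset.card_image_le
    _ = d := by simp

end Model

end Literature.Computability.MetaComplexity

namespace Literature.Computability.MetaComplexity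

open Finset

section Counting

variable {m d n p : ℕ} [Fact p.Prime]

/-- `|𝔽_p^×| = p - 1`. [folklore] -/
theorem card_units_zmod : Fintype.card (ZMod p)ˣ = p - 1 := by
  rw [Fintype.card_units, ZMod.card]

/-- The number of samples. [folklore] -/
theorem card_pickSpace : Fintype.card (PickSpace m d n p) = (n * (p - 1)) ^ (m * d) := by
  rw [Fintype.card_fun, Fintype.card_prod, Fintype.card_fin, card_units_zmod, Fintype.card_prod,
    Fintype.card_fin, Fintype.card_fin]

/-- The number of picks inside a set of columns. [folklore] -/
theorem card_pick_mem (U : Finset (Fin n)) :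
    Fintype.card {b : Pick n p // b.1 ∈ U} = U.card * (p - 1) := by
  rw [Fintype.card_congr ((Equiv.subtypeProdEquivSigmaSubtype fun (a : Fin n) (_ : (ZMod p)ˣ) => a ∈ U)),
    Fintype.card_sigma]
  simp only [Fintype.card_subtype]
  rw [← Finset.sum_filter_add_sum_filter_not univ (· ∈ U)]
  have h1 : ∑ a ∈ univ.filter (· ∈ U), ((univ : Finset (ZMod p)ˣ).filter fun _ => a ∈ U).card =
      ∑ a ∈ univ.filter (· ∈ U), (p - 1) :=
    Finset.sum_congr rfl fun a ha => by
      rw [Finset.filter_true_of_mem fun _ _ => (Finset.mem_filter.1 ha).2, Finset.card_univ, card_units_zmod]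
  have h2 : ∑ a ∈ univ.filter (· ∉ U), ((univ : Finset (ZMod p)ˣ).filter fun _ => a ∈ U).card = 0 :=
    Finset.sum_eq_zero fun a ha => by
      rw [Finset.filter_false_of_mem fun _ _ => (Finset.mem_filter.1 ha).2, Finset.card_empty]
  rw [h1, h2, add_zero, Finset.sum_const, smul_eq_mul]
  congr 1
  rw [Finset.filter_mem_eq_inter, Finset.univ_inter]

/-- **Confined picks** (independence of the picks): the samples in which all picks of the
rows of `S` land in the column set `U` number exactly `|Ω| · (|U|/n)^{|S| d}`.
[Beck 2017, Lemma 5.2 (proof: "the chance that it is missed is at most `(1 - d/n)^{|S|}`")]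
[cite: Beck2017, Lemma 5.2 (proof)] -/
theorem card_confined (S : Finset (Fin m)) (U : Finset (Fin n)) :
    Fintype.card {ω : PickSpace m d n p // ∀ x, x.1 ∈ S → (ω x).1 ∈ U} =
      (U.card * (p - 1)) ^ (S.card * d) * (n * (p - 1)) ^ ((m - S.card) * d) := by
  classical
  rw [Fintype.card_congr (Equiv.subtypePiEquivPi (p := fun (x : Fin m × Fin d) (b : Pick n p) => x.1 ∈ S → b.1 ∈ U)),
    Fintype.card_pi]
  have hx : ∀ x : Fin m × Fin d, Fintype.card {b : Pick n p // x.1 ∈ S → b.1 ∈ U} =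
      if x.1 ∈ S then U.card * (p - 1) else n * (p - 1) := by
    intro x
    split_ifs with h
    · rw [← card_pick_mem (p := p) U]
      exact Fintype.card_congr (Equiv.subtypeEquivRight fun b => by simp [h])
    · have : Fintype.card {b : Pick n p // x.1 ∈ S → b.1 ∈ U} = Fintype.card (Pick n p) :=
        Fintype.card_congr ((Equiv.subtypeEquivRight fun b => by simp [h]).trans
          (Equiv.subtypeUnivEquiv fun _ => trivial))
      rw [this, Fintype.card_prod, Fintype.card_fin, card_units_zmod]
  simp_rw [hx]
  rw [Finset.prod_ite, Finset.prod_const, Finset.prod_const]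
  congr 2
  · have : (univ.filter fun x : Fin m × Fin d => x.1 ∈ S) = S ×ˢ (univ : Finset (Fin d)) := by ext x; simp
    rw [this, Finset.card_product, Finset.card_univ, Fintype.card_fin]
  · have : (univ.filter fun x : Fin m × Fin d => x.1 ∉ S) = Sᶜ ×ˢ (univ : Finset (Fin d)) := by ext x; simp
    rw [this, Finset.card_product, Finset.card_univ, Fintype.card_fin, Finset.card_compl, Fintype.card_fin]

/-- Confined picks as a fraction of the sample space: `|E| · n^{|S|d} = |Ω| · |U|^{|S|d}`.
[Beck 2017, Lemma 5.2 (proof)] [folklore] -/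
theorem card_confined_mul (S : Finset (Fin m)) (U : Finset (Fin n)) :
    Fintype.card {ω : PickSpace m d n p // ∀ x, x.1 ∈ S → (ω x).1 ∈ U} * n ^ (S.card * d) =
      Fintype.card (PickSpace m d n p) * U.card ^ (S.card * d) := by
  rw [card_confined, card_pickSpace]
  have hs : S.card ≤ m := by simpa using Finset.card_le_univ S
  have : m * d = S.card * d + (m - S.card) * d := by rw [← Nat.add_mul, Nat.add_sub_cancel' hs]
  rw [this, pow_add, mul_pow, mul_pow, mul_pow]
  ring

/-! ### Vanishing columns -/

/-- Hits, read from the column part of a sample. [folklore] -/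
def hitsC (c : Fin m × Fin d → Fin n) (S : Finset (Fin m)) (j : Fin n) : Finset (Fin m × Fin d) :=
  univ.filter fun x => x.1 ∈ S ∧ c x = j

/-- The combination, read from the column and value parts of a sample. [folklore] -/
def combC (c : Fin m × Fin d → Fin n) (u : Fin m × Fin d → (ZMod p)ˣ) (v : Fin m → ZMod p)
    (S : Finset (Fin m)) (j : Fin n) : ZMod p :=
  ∑ x ∈ hitsC c S j, v x.1 * (u x : ZMod p)

omit [Fact p.Prime] in
/-- Membership in `hitsC`. [folklore] -/
theorem mem_hitsC {c : Fin m × Fin d → Fin n} {S : Finset (Fin m)} {j : Fin n} {x : Fin m × Fin d} :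
    x ∈ hitsC c S j ↔ x.1 ∈ S ∧ c x = j := by
  simp [hitsC]

/-- Splitting a sample into columns and values. [folklore] -/
def splitPick (m d n p : ℕ) : PickSpace m d n p ≃ (Fin m × Fin d → Fin n) × (Fin m × Fin d → (ZMod p)ˣ) :=
  Equiv.arrowProdEquivProdArrow _ _ _

omit [Fact p.Prime] in
/-- `hits` only depends on the column part of the sample. [folklore] -/
theorem hits_eq_hitsC (ω : PickSpace m d n p) (S : Finset (Fin m)) (j : Fin n) :
    hits ω S j = hitsC (splitPick m d n p ω).1 S j := by
  ext x; simp [mem_hits, mem_hitsC, splitPick, Equiv.arrowProdEquivProdArrow]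

/-- The combination in terms of the column and value parts. [folklore] -/
theorem combVec_eq_combC (ω : PickSpace m d n p) (v : Fin m → ZMod p) {S : Finset (Fin m)}
    (hS : ∀ i, v i ≠ 0 → i ∈ S) (j : Fin n) :
    combVec ω v j = combC (splitPick m d n p ω).1 (splitPick m d n p ω).2 v S j := by
  rw [combVec_eq_sum_hits ω v j hS, combC, hits_eq_hitsC]
  rfl

/-- **Fibre bound**: for fixed columns covering `T`, the value assignments making the
combination vanish on `T` are at most a `(p-1)^{-|T|}` fraction — designate one pick per
column of `T`; given all other values, each designated value is determined.
[Beck 2017, Lemma 5.2 (proof: "take nonzero values with probability at least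
`1 - 1/(p-1)`", independence across coordinates)] [cite: Beck2017, Lemma 5.2 (proof)] -/
theorem card_vals_zero_le (c : Fin m × Fin d → Fin n) (v : Fin m → ZMod p) {S : Finset (Fin m)}
    (hS : ∀ i, v i ≠ 0 ↔ i ∈ S) (T : Finset (Fin n)) (hT : ∀ j ∈ T, (hitsC c S j).Nonempty) :
    Fintype.card {u : Fin m × Fin d → (ZMod p)ˣ // ∀ j ∈ T, combC c u v S j = 0} * (p - 1) ^ T.card ≤
      (p - 1) ^ (m * d) := by
  classical
  -- designated picks
  let π : T → Fin m × Fin d := fun j => (hT j.1 j.2).choose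
  have hπ : ∀ j : T, π j ∈ hitsC c S j := fun j => (hT j.1 j.2).choose_spec
  have hπinj : Function.Injective π := by
    intro j j' h
    apply Subtype.ext
    have h1 := (mem_hitsC.1 (hπ j)).2
    have h2 := (mem_hitsC.1 (hπ j')).2
    rw [h] at h1
    exact h1.symm.trans h2
  let D : Finset (Fin m × Fin d) := univ.image π
  have hDcard : D.card = T.card := by
    rw [Finset.card_image_of_injective _ hπinj, Finset.card_univ, Fintype.card_coe]
  -- restriction off `D` is injective on the vanishing assignments
  let f : {u : Fin m × Fin d → (ZMod p)ˣ // ∀ j ∈ T, combC c u v S j = 0} →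
      ({x : Fin m × Fin d // x ∉ D} → (ZMod p)ˣ) := fun u x => u.1 x.1
  have hf : Function.Injective f := by
    intro u₁ u₂ h
    apply Subtype.ext
    funext x
    by_cases hx : x ∈ D
    · obtain ⟨j₀, -, rfl⟩ := Finset.mem_image.1 hx
      have hmem := hπ j₀
      have hz₁ := u₁.2 j₀.1 j₀.2
      have hz₂ := u₂.2 j₀.1 j₀.2
      rw [combC, ← Finset.add_sum_erase _ _ hmem] at hz₁ hz₂
      have hrest : ∑ y ∈ (hitsC c S j₀).erase (π j₀), v y.1 * (u₁.1 y : ZMod p) =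
          ∑ y ∈ (hitsC c S j₀).erase (π j₀), v y.1 * (u₂.1 y : ZMod p) := by
        refine Finset.sum_congr rfl fun y hy => ?_
        obtain ⟨hyne, hy⟩ := Finset.mem_erase.1 hy
        have hyD : y ∉ D := by
          intro hyD
          obtain ⟨j₁, -, rfl⟩ := Finset.mem_image.1 hyD
          have : j₁ = j₀ := by
            apply Subtype.ext
            exact (mem_hitsC.1 (hπ j₁)).2.symm.trans (mem_hitsC.1 hy).2
          exact hyne (by rw [this])
        have := congrFun h ⟨y, hyD⟩
        simp only [f] at this
        rw [this]
      rw [hrest] at hz₁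
      have hv : v (π j₀).1 ≠ 0 := (hS _).2 (mem_hitsC.1 hmem).1
      have : v (π j₀).1 * (u₁.1 (π j₀) : ZMod p) = v (π j₀).1 * (u₂.1 (π j₀) : ZMod p) :=
        add_right_cancel (hz₁.trans hz₂.symm)
      exact Units.ext (mul_left_cancel₀ hv this)
    · exact congrFun h ⟨x, hx⟩
  calc Fintype.card {u : Fin m × Fin d → (ZMod p)ˣ // ∀ j ∈ T, combC c u v S j = 0} * (p - 1) ^ T.card
      ≤ Fintype.card ({x : Fin m × Fin d // x ∉ D} → (ZMod p)ˣ) * (p - 1) ^ T.card :=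
        Nat.mul_le_mul_right _ (Fintype.card_le_of_injective f hf)
    _ = (p - 1) ^ (m * d) := by
        rw [Fintype.card_fun, card_units_zmod, Fintype.card_subtype_compl, Fintype.card_coe, hDcard,
          ← pow_add, Fintype.card_prod, Fintype.card_fin, Fintype.card_fin]
        congr 1
        have : T.card ≤ m * d := by
          rw [← hDcard]
          simpa using Finset.card_le_univ D
        omega

/-- **Vanishing on covered columns is rare**: the samples in which the picks of `S` cover `T`
and the combination `v` (supported exactly on `S`) vanishes on all of `T` are at most a
`(p-1)^{-|T|}` fraction of all samples. [Beck 2017, Lemma 5.2 (proof)]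
[cite: Beck2017, Lemma 5.2 (proof)] -/
theorem card_zeros_mul_le (v : Fin m → ZMod p) {S : Finset (Fin m)} (hS : ∀ i, v i ≠ 0 ↔ i ∈ S)
    (T : Finset (Fin n)) :
    Fintype.card {ω : PickSpace m d n p // T ⊆ covered ω S ∧ ∀ j ∈ T, combVec ω v j = 0} *
      (p - 1) ^ T.card ≤ Fintype.card (PickSpace m d n p) := by
  classical
  -- move to (columns, values) and sum over the columns
  let Q : (Fin m × Fin d → Fin n) → (Fin m × Fin d → (ZMod p)ˣ) → Prop := fun c u =>
    (∀ j ∈ T, (hitsC c S j).Nonempty) ∧ ∀ j ∈ T, combC c u v S j = 0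
  have hequiv : {ω : PickSpace m d n p // T ⊆ covered ω S ∧ ∀ j ∈ T, combVec ω v j = 0} ≃
      {cu : (Fin m × Fin d → Fin n) × (Fin m × Fin d → (ZMod p)ˣ) // Q cu.1 cu.2} := by
    refine (splitPick m d n p).subtypeEquiv fun ω => ?_
    simp only [Q]
    refine and_congr (forall₂_congr fun j _ => ?_) (forall₂_congr fun j _ => ?_)
    · rw [mem_covered, Finset.Nonempty]
      simp only [← mem_hits, hits_eq_hitsC]
    · rw [combVec_eq_combC ω v (fun i hi => (hS i).1 hi)]
  rw [Fintype.card_congr hequiv, Fintype.card_congr (Equiv.subtypeProdEquivSigmaSubtype Q),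
    Fintype.card_sigma, Finset.sum_mul]
  calc ∑ c, Fintype.card {u // Q c u} * (p - 1) ^ T.card
      ≤ ∑ c : Fin m × Fin d → Fin n, (p - 1) ^ (m * d) := Finset.sum_le_sum fun c _ => by
        by_cases hc : ∀ j ∈ T, (hitsC c S j).Nonempty
        · have : Fintype.card {u // Q c u} = Fintype.card {u : Fin m × Fin d → (ZMod p)ˣ // ∀ j ∈ T, combC c u v S j = 0} :=
            Fintype.card_congr (Equiv.subtypeEquivRight fun u => by
              simp only [Q]; exact ⟨fun h => h.2, fun h => ⟨hc, h⟩⟩)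
          rw [this]
          exact card_vals_zero_le c v hS T hc
        · have : Fintype.card {u // Q c u} = 0 :=
            Fintype.card_eq_zero_iff.2 ⟨fun u => hc u.2.1⟩
          rw [this, zero_mul]
          exact Nat.zero_le _
    _ = Fintype.card (PickSpace m d n p) := by
        rw [Finset.sum_const, smul_eq_mul, Finset.card_univ, Fintype.card_fun, Fintype.card_fin,
          Fintype.card_prod, Fintype.card_fin, Fintype.card_fin, card_pickSpace, mul_pow, mul_comm]

end Counting

end Literature.Computability.MetaComplexity

namespace Literature.Computability.MetaComplexity

open Finset

section UnionBounds

variable {m d n p : ℕ} [Fact p.Prime]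

/-- Union bound over a finite index set. [folklore] -/
theorem card_filter_exists_le {α β : Type*} [Fintype α] (A : Finset β) (P : β → α → Prop)
    [∀ b, DecidablePred (P b)] [DecidablePred fun a => ∃ b ∈ A, P b a] :
    (univ.filter fun a => ∃ b ∈ A, P b a).card ≤ ∑ b ∈ A, (univ.filter (P b)).card := by
  classical
  have : (univ.filter fun a => ∃ b ∈ A, P b a) = A.biUnion fun b => univ.filter (P b) := by
    ext a; simp
  rw [this]
  exact Finset.card_biUnion_le

/-! ### The events -/

open Classical in
/-- The samples whose picks of the rows of `S` all land in `U`. [Beck 2017, Lemma 5.2 (proof)]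
[folklore] -/
noncomputable def confinedEvent (S : Finset (Fin m)) (U : Finset (Fin n)) : Finset (PickSpace m d n p) :=
  univ.filter fun ω => ∀ x, x.1 ∈ S → (ω x).1 ∈ U

open Classical in
/-- The samples whose picks of the rows of `S` cover at most `L` columns. [Beck 2017, Lemma 5.2
(proof)] [folklore] -/
noncomputable def coverFail (S : Finset (Fin m)) (L : ℕ) : Finset (PickSpace m d n p) :=
  univ.filter fun ω => (covered ω S).card ≤ L

open Classical in
/-- The samples in which some `t` columns covered by the rows of `S` have all coordinates of
the combination `v` equal to zero. [Beck 2017, Lemma 5.2 (proof)] [folklore] -/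
noncomputable def zerosEvent (v : Fin m → ZMod p) (S : Finset (Fin m)) (t : ℕ) : Finset (PickSpace m d n p) :=
  univ.filter fun ω => ∃ T ∈ (univ : Finset (Fin n)).powersetCard t,
    T ⊆ covered ω S ∧ ∀ j ∈ T, combVec ω v j = 0

open Classical in
/-- The samples on which the combination `v` vanishes identically. [Bonacina 2017,
Prop. 8.1(2)] [folklore] -/
noncomputable def kernelEvent (d n : ℕ) (v : Fin m → ZMod p) : Finset (PickSpace m d n p) :=
  univ.filter fun ω => ∀ j, combVec ω v j = 0

open Classical in
/-- The samples on which the combination `v` has fewer than `W` non-zero coordinates.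
[Bonacina 2017, Prop. 8.1(3)] [folklore] -/
noncomputable def expFail (d : ℕ) (v : Fin m → ZMod p) (W : ℝ) : Finset (PickSpace m d n p) :=
  univ.filter fun ω => ((univ.filter fun j => combVec ω v j ≠ 0).card : ℝ) < W

/-- Membership in `confinedEvent`. [folklore] -/
theorem mem_confinedEvent {S : Finset (Fin m)} {U : Finset (Fin n)} {ω : PickSpace m d n p} :
    ω ∈ confinedEvent S U ↔ ∀ x, x.1 ∈ S → (ω x).1 ∈ U := by
  simp [confinedEvent]

/-- Membership in `coverFail`. [folklore] -/
theorem mem_coverFail {S : Finset (Fin m)} {L : ℕ} {ω : PickSpace m d n p} :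
    ω ∈ coverFail S L ↔ (covered ω S).card ≤ L := by
  simp [coverFail]

/-- Membership in `zerosEvent`. [folklore] -/
theorem mem_zerosEvent {v : Fin m → ZMod p} {S : Finset (Fin m)} {t : ℕ} {ω : PickSpace m d n p} :
    ω ∈ zerosEvent v S t ↔ ∃ T ∈ (univ : Finset (Fin n)).powersetCard t,
      T ⊆ covered ω S ∧ ∀ j ∈ T, combVec ω v j = 0 := by
  simp only [zerosEvent, Finset.mem_filter, Finset.mem_univ, true_and]

/-- Membership in `kernelEvent`. [folklore] -/
theorem mem_kernelEvent {v : Fin m → ZMod p} {ω : PickSpace m d n p} :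
    ω ∈ kernelEvent d n v ↔ ∀ j, combVec ω v j = 0 := by
  simp [kernelEvent]

/-- Membership in `expFail`. [folklore] -/
theorem mem_expFail {v : Fin m → ZMod p} {W : ℝ} {ω : PickSpace m d n p} :
    ω ∈ expFail d v W ↔ ((univ.filter fun j => combVec ω v j ≠ 0).card : ℝ) < W := by
  simp only [expFail, Finset.mem_filter, Finset.mem_univ, true_and]

/-- Confined picks, as a real fraction of the samples. [Beck 2017, Lemma 5.2 (proof)] [folklore] -/
theorem card_confined_real (hn : 0 < n) (S : Finset (Fin m)) (U : Finset (Fin n)) :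
    ((confinedEvent (d := d) (p := p) S U).card : ℝ) =
      Fintype.card (PickSpace m d n p) * ((U.card : ℝ) / n) ^ (S.card * d) := by
  classical
  have h := card_confined_mul (m := m) (d := d) (n := n) (p := p) S U
  have hcard : Fintype.card {ω : PickSpace m d n p // ∀ x, x.1 ∈ S → (ω x).1 ∈ U} =
      (confinedEvent (d := d) (p := p) S U).card := by
    rw [Fintype.card_subtype]
    congr 1
  rw [hcard] at h
  have h' : (((confinedEvent (d := d) (p := p) S U).card : ℕ) : ℝ) *
      (n : ℝ) ^ (S.card * d) = Fintype.card (PickSpace m d n p) * (U.card : ℝ) ^ (S.card * d) := by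
    exact_mod_cast h
  have hnpos : (0 : ℝ) < (n : ℝ) ^ (S.card * d) := by positivity
  rw [div_pow, ← mul_div_assoc, eq_div_iff hnpos.ne']
  exact h'

/-- **Coverage failure** (Beck 2017, Lemma 5.2, proof: "any set `S` of rows … has ones in at
least `(1-O(1/√d))n` columns" — union bound over the missed set): the samples in which the
picks of `S` cover at most `L ≤ n` columns are at most `C(n,L) (L/n)^{|S|d} |Ω|`.
[cite: Beck2017, Lemma 5.2 (proof, coverage)] -/
theorem card_cover_le (hn : 0 < n) (S : Finset (Fin m)) {L : ℕ} (hL : L ≤ n) :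
    ((coverFail (d := d) (n := n) (p := p) S L).card : ℝ) ≤
      (n.choose L : ℝ) * Fintype.card (PickSpace m d n p) * ((L : ℝ) / n) ^ (S.card * d) := by
  classical
  have hsub : coverFail (d := d) (n := n) (p := p) S L ⊆
      ((univ : Finset (Fin n)).powersetCard L).biUnion fun U => confinedEvent S U := by
    intro ω hω
    rw [mem_coverFail] at hω
    rw [Finset.mem_biUnion]
    obtain ⟨U, hcovU, hUcard⟩ := Finset.exists_superset_card_eq hω (by simpa using hL)
    refine ⟨U, Finset.mem_powersetCard.2 ⟨Finset.subset_univ _, hUcard⟩, mem_confinedEvent.2 fun x hx => ?_⟩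
    exact hcovU (mem_covered.2 ⟨x, hx, rfl⟩)
  calc ((coverFail (d := d) (n := n) (p := p) S L).card : ℝ)
      ≤ ((((univ : Finset (Fin n)).powersetCard L).biUnion fun U => confinedEvent (d := d) (p := p) S U).card : ℝ) := by
        exact_mod_cast Finset.card_le_card hsub
    _ ≤ ∑ U ∈ (univ : Finset (Fin n)).powersetCard L, ((confinedEvent (d := d) (p := p) S U).card : ℝ) := by
        exact_mod_cast Finset.card_biUnion_le
    _ = ∑ U ∈ (univ : Finset (Fin n)).powersetCard L,
          (Fintype.card (PickSpace m d n p) : ℝ) * ((L : ℝ) / n) ^ (S.card * d) :=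
        Finset.sum_congr rfl fun U hU => by
          rw [card_confined_real hn, (Finset.mem_powersetCard.1 hU).2]
    _ = _ := by rw [Finset.sum_const, Finset.card_powersetCard, Finset.card_univ, Fintype.card_fin, nsmul_eq_mul, mul_assoc]

/-- **Many vanishing covered columns** (union bound over the vanishing set): the samples in
which some `t`-set of covered columns has all coordinates of the combination zero are at most
`C(n,t) (p-1)^{-t} |Ω|`. [Beck 2017, Lemma 5.2 (proof)] [cite: Beck2017, Lemma 5.2 (proof)] -/
theorem card_zeros_exists_le (hp : 2 ≤ p) (v : Fin m → ZMod p) {S : Finset (Fin m)}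
    (hS : ∀ i, v i ≠ 0 ↔ i ∈ S) (t : ℕ) :
    ((zerosEvent (d := d) (n := n) v S t).card : ℝ) ≤
      (n.choose t : ℝ) * Fintype.card (PickSpace m d n p) / ((p : ℝ) - 1) ^ t := by
  classical
  have hp1 : (0 : ℝ) < (p : ℝ) - 1 := by
    have : (2 : ℝ) ≤ p := by exact_mod_cast hp
    linarith
  have hsub : zerosEvent (d := d) (n := n) v S t ⊆ ((univ : Finset (Fin n)).powersetCard t).biUnion fun T =>
      univ.filter fun ω : PickSpace m d n p => T ⊆ covered ω S ∧ ∀ j ∈ T, combVec ω v j = 0 := by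
    intro ω hω
    obtain ⟨T, hT, h⟩ := mem_zerosEvent.1 hω
    exact Finset.mem_biUnion.2 ⟨T, hT, Finset.mem_filter.2 ⟨Finset.mem_univ _, h⟩⟩
  calc ((zerosEvent (d := d) (n := n) v S t).card : ℝ)
      ≤ ((((univ : Finset (Fin n)).powersetCard t).biUnion fun T =>
          univ.filter fun ω : PickSpace m d n p => T ⊆ covered ω S ∧ ∀ j ∈ T, combVec ω v j = 0).card : ℝ) := by
        exact_mod_cast Finset.card_le_card hsub
    _ ≤ ∑ T ∈ (univ : Finset (Fin n)).powersetCard t,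
          ((univ.filter fun ω : PickSpace m d n p => T ⊆ covered ω S ∧ ∀ j ∈ T, combVec ω v j = 0).card : ℝ) := by
        exact_mod_cast Finset.card_biUnion_le
    _ ≤ ∑ T ∈ (univ : Finset (Fin n)).powersetCard t,
          (Fintype.card (PickSpace m d n p) : ℝ) / ((p : ℝ) - 1) ^ t :=
        Finset.sum_le_sum fun T hT => by
          rw [le_div_iff₀ (pow_pos hp1 t)]
          have h := card_zeros_mul_le (m := m) (d := d) (n := n) v hS T
          rw [Fintype.card_subtype, (Finset.mem_powersetCard.1 hT).2] at h
          have h' : (((univ.filter fun ω : PickSpace m d n p => T ⊆ covered ω S ∧ ∀ j ∈ T,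
              combVec ω v j = 0).card : ℕ) : ℝ) * ((p - 1 : ℕ) : ℝ) ^ t ≤ Fintype.card (PickSpace m d n p) := by
            exact_mod_cast h
          rwa [Nat.cast_sub (by omega), Nat.cast_one] at h'
    _ = _ := by
        rw [Finset.sum_const, Finset.card_powersetCard, Finset.card_univ, Fintype.card_fin, nsmul_eq_mul,
          mul_div_assoc]

/-- Zeros inside the covered set: if the combination has fewer than `|covered| - t + 1`
non-zero coordinates, some `t` covered columns all vanish. [folklore] -/
theorem mem_zerosEvent_of_few_nonzero (ω : PickSpace m d n p) (v : Fin m → ZMod p) (S : Finset (Fin m))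
    {t : ℕ} (h : (univ.filter fun j => combVec ω v j ≠ 0).card + t ≤ (covered ω S).card) :
    ω ∈ zerosEvent v S t := by
  rw [mem_zerosEvent]
  classical
  have hZcard : t ≤ ((covered ω S).filter fun j => combVec ω v j = 0).card := by
    have h1 := Finset.card_filter_add_card_filter_not (s := covered ω S) (fun j => combVec ω v j = 0)
    have h2 : ((covered ω S).filter fun j => ¬ combVec ω v j = 0).card ≤
        (univ.filter fun j => combVec ω v j ≠ 0).card :=
      Finset.card_le_card (Finset.filter_subset_filter _ (Finset.subset_univ _))
    omega
  obtain ⟨T, hTZ, hTcard⟩ := Finset.exists_subset_card_eq hZcard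
  refine ⟨T, Finset.mem_powersetCard.2 ⟨Finset.subset_univ _, hTcard⟩,
    fun j hj => (Finset.mem_filter.1 (hTZ hj)).1, fun j hj => (Finset.mem_filter.1 (hTZ hj)).2⟩

/-- A combination vanishing everywhere hits no column exactly once, so its rows' picks cover
at most `|S|d/2` columns. [Beck 2017, Lemma 5.2 (proof, unique neighbours)] [folklore] -/
theorem card_covered_le_of_combVec_eq_zero {ω : PickSpace m d n p} {v : Fin m → ZMod p}
    {S : Finset (Fin m)} (hS : ∀ i, v i ≠ 0 ↔ i ∈ S) (h : ∀ j, combVec ω v j = 0) :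
    2 * (covered ω S).card ≤ S.card * d := by
  refine two_mul_card_covered_le fun j hj => ?_
  have hne : (hits ω S j).Nonempty := (Finset.mem_filter.1 hj).2
  by_contra hlt
  have h1 : (hits ω S j).card = 1 := by
    have := Finset.card_pos.2 hne; omega
  exact combVec_ne_zero_of_card_hits_eq_one hS h1 (h j)

end UnionBounds

end Literature.Computability.MetaComplexity

namespace Literature.Computability.MetaComplexity

open Finset Real

/-- `C(n,k) ≤ (e n / k)^k` (from `C(n,k) ≤ n^k/k!` and `k^k/k! ≤ e^k`). [folklore] -/
theorem choose_le_epow (n : ℕ) {k : ℕ} (hk : 1 ≤ k) :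
    (n.choose k : ℝ) ≤ (Real.exp 1 * n / k) ^ k := by
  have h1 : (n.choose k : ℝ) ≤ (n : ℝ) ^ k / k.factorial := Nat.choose_le_pow_div k n
  have h2 : (k : ℝ) ^ k / k.factorial ≤ Real.exp 1 ^ k := by
    have := Real.pow_div_factorial_le_exp (k : ℝ) (Nat.cast_nonneg k) k
    rwa [← Real.exp_one_pow] at this
  have hkpos : (0 : ℝ) < k := by exact_mod_cast hk
  have hfact : (0 : ℝ) < k.factorial := by exact_mod_cast Nat.factorial_pos k
  rw [div_pow, mul_pow, le_div_iff₀ (pow_pos hkpos k)]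
  calc (n.choose k : ℝ) * (k : ℝ) ^ k ≤ (n : ℝ) ^ k / k.factorial * (k : ℝ) ^ k :=
        mul_le_mul_of_nonneg_right h1 (by positivity)
    _ = (n : ℝ) ^ k * ((k : ℝ) ^ k / k.factorial) := by ring
    _ ≤ (n : ℝ) ^ k * Real.exp 1 ^ k := mul_le_mul_of_nonneg_left h2 (by positivity)
    _ = Real.exp 1 ^ k * (n : ℝ) ^ k := by ring

/-- `(1 - x)^k ≤ e^{-xk}` for `0 ≤ x ≤ 1`. [folklore] -/
theorem one_sub_pow_le_exp {x : ℝ} (hx1 : x ≤ 1) (k : ℕ) :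
    (1 - x) ^ k ≤ Real.exp (-(x * k)) := by
  calc (1 - x) ^ k ≤ (Real.exp (-x)) ^ k :=
        pow_le_pow_left₀ (by linarith) (Real.one_sub_le_exp_neg x) k
    _ = Real.exp (-(x * k)) := by rw [← Real.exp_nat_mul]; ring_nf

section Vectors

variable {m p : ℕ} [Fact p.Prime]

/-- Vectors with a prescribed support are determined by their non-zero values. [folklore] -/
theorem card_vsupp_eq_le (S : Finset (Fin m)) :
    ((univ.filter fun v : Fin m → ZMod p => vsupp v = S).card : ℝ) ≤ ((p : ℝ) - 1) ^ S.card := by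
  classical
  have hp := (Fact.out : p.Prime).two_le
  let f : {v : Fin m → ZMod p // vsupp v = S} → (S → (ZMod p)ˣ) := fun v i =>
    Units.mk0 (v.1 i) (by
      have : (i : Fin m) ∈ vsupp v.1 := by rw [v.2]; exact i.2
      exact (Finset.mem_filter.1 this).2)
  have hf : Function.Injective f := by
    intro v w h
    apply Subtype.ext
    funext i
    by_cases hi : i ∈ S
    · have := congrFun h ⟨i, hi⟩
      simpa [f, Units.ext_iff] using this
    · have hv : v.1 i = 0 := by
        by_contra hne
        exact hi (v.2 ▸ Finset.mem_filter.2 ⟨Finset.mem_univ _, hne⟩)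
      have hw : w.1 i = 0 := by
        by_contra hne
        exact hi (w.2 ▸ Finset.mem_filter.2 ⟨Finset.mem_univ _, hne⟩)
      rw [hv, hw]
  have h := Fintype.card_le_of_injective f hf
  rw [Fintype.card_subtype, Fintype.card_fun, Fintype.card_coe, card_units_zmod] at h
  have h' : (((univ.filter fun v : Fin m → ZMod p => vsupp v = S).card : ℕ) : ℝ) ≤ (((p - 1) ^ S.card : ℕ) : ℝ) := by
    exact_mod_cast h
  rwa [Nat.cast_pow, Nat.cast_sub (by omega), Nat.cast_one] at h'

/-- **Counting coefficient vectors by support size**: at most `C(m,s) (p-1)^s` vectors have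
support of size `s`. [folklore] -/
theorem card_vsupp_card_eq_le (s : ℕ) :
    ((univ.filter fun v : Fin m → ZMod p => (vsupp v).card = s).card : ℝ) ≤
      (m.choose s : ℝ) * ((p : ℝ) - 1) ^ s := by
  classical
  have hsub : (univ.filter fun v : Fin m → ZMod p => (vsupp v).card = s) ⊆
      univ.filter fun v => ∃ S ∈ (univ : Finset (Fin m)).powersetCard s, vsupp v = S := by
    intro v hv
    rw [Finset.mem_filter] at hv ⊢
    exact ⟨hv.1, vsupp v, Finset.mem_powersetCard.2 ⟨Finset.subset_univ _, hv.2⟩, rfl⟩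
  calc ((univ.filter fun v : Fin m → ZMod p => (vsupp v).card = s).card : ℝ)
      ≤ ((univ.filter fun v : Fin m → ZMod p => ∃ S ∈ (univ : Finset (Fin m)).powersetCard s, vsupp v = S).card : ℝ) := by
        exact_mod_cast Finset.card_le_card hsub
    _ ≤ ∑ S ∈ (univ : Finset (Fin m)).powersetCard s, ((univ.filter fun v : Fin m → ZMod p => vsupp v = S).card : ℝ) := by
        exact_mod_cast card_filter_exists_le ((univ : Finset (Fin m)).powersetCard s)
          (fun S (v : Fin m → ZMod p) => vsupp v = S)
    _ ≤ ∑ S ∈ (univ : Finset (Fin m)).powersetCard s, ((p : ℝ) - 1) ^ s :=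
        Finset.sum_le_sum fun S hS => by
          rw [← (Finset.mem_powersetCard.1 hS).2]; exact card_vsupp_eq_le S
    _ = _ := by rw [Finset.sum_const, Finset.card_powersetCard, Finset.card_univ, Fintype.card_fin, nsmul_eq_mul]

end Vectors

end Literature.Computability.MetaComplexity

namespace Literature.Computability.MetaComplexity

open Finset Real

section PerVector

variable {m d n p : ℕ} [Fact p.Prime]

/-- **Small supports** (unique-neighbour regime): if `v` has support `S` of size `s ≥ 1` with
`4sd ≤ n` and `d = 2d'`, the samples on which `Σ v_i row_i = 0` are at most
`(e s d'/n)^{s d'} C(n, s d')`-few: `≤ C(n,sd') (sd'/n)^{sd} |Ω|`.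
[Beck 2017, Lemma 5.2 (proof, small sets: "expand by a factor Ω(√d)")]
[cite: Beck2017, Lemma 5.2 (proof, small sets)] -/
theorem card_kernel_small_le (hn : 0 < n) {d' : ℕ} (v : Fin m → ZMod p)
    {S : Finset (Fin m)} (hS : ∀ i, v i ≠ 0 ↔ i ∈ S) (h4 : 4 * (S.card * (2 * d')) ≤ n) :
    ((kernelEvent (2 * d') n v).card : ℝ) ≤
      (n.choose (S.card * d') : ℝ) * (Fintype.card (PickSpace m (2 * d') n p) : ℝ) *
        (((S.card * d' : ℕ) : ℝ) / n) ^ (S.card * (2 * d')) := by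
  classical
  have hsub : kernelEvent (2 * d') n v ⊆ coverFail (d := 2 * d') (n := n) (p := p) S (S.card * d') := by
    intro ω hω
    rw [mem_kernelEvent] at hω
    rw [mem_coverFail]
    have h := card_covered_le_of_combVec_eq_zero hS hω
    have : S.card * (2 * d') = 2 * (S.card * d') := by ring
    rw [this] at h
    exact Nat.le_of_mul_le_mul_left h (by norm_num)
  have hL : S.card * d' ≤ n := by nlinarith
  calc ((kernelEvent (2 * d') n v).card : ℝ) ≤ (coverFail (d := 2 * d') (n := n) (p := p) S (S.card * d')).card := by
        exact_mod_cast Finset.card_le_card hsub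
    _ ≤ _ := card_cover_le hn S hL

/-- **Large supports, vanishing combination**: either few columns are covered, or some
`k+1` covered columns all vanish. [Beck 2017, Lemma 5.2 (proof)] [folklore] -/
theorem card_kernel_large_le (hn : 0 < n) (hp : 2 ≤ p) (v : Fin m → ZMod p) {S : Finset (Fin m)}
    (hS : ∀ i, v i ≠ 0 ↔ i ∈ S) {k : ℕ} (hk : k + 1 ≤ n) :
    ((kernelEvent d n v).card : ℝ) ≤
      (n.choose k : ℝ) * (Fintype.card (PickSpace m d n p) : ℝ) * ((k : ℝ) / n) ^ (S.card * d) +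
        (n.choose (k + 1) : ℝ) * (Fintype.card (PickSpace m d n p) : ℝ) / ((p : ℝ) - 1) ^ (k + 1) := by
  classical
  have hsub : kernelEvent d n v ⊆ coverFail (d := d) (n := n) (p := p) S k ∪ zerosEvent v S (k + 1) := by
    intro ω hω
    rw [mem_kernelEvent] at hω
    rw [Finset.mem_union, mem_coverFail]
    by_cases hc : (covered ω S).card ≤ k
    · exact Or.inl hc
    · refine Or.inr (mem_zerosEvent_of_few_nonzero ω v S ?_)
      have : (univ.filter fun j => combVec ω v j ≠ 0).card = 0 := by
        rw [Finset.card_eq_zero, Finset.filter_eq_empty_iff]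
        intro j _; simp [hω j]
      omega
  calc ((kernelEvent d n v).card : ℝ)
      ≤ ((coverFail (d := d) (n := n) (p := p) S k ∪ zerosEvent v S (k + 1)).card : ℝ) := by
        exact_mod_cast Finset.card_le_card hsub
    _ ≤ ((coverFail (d := d) (n := n) (p := p) S k).card : ℝ) + ((zerosEvent (d := d) (n := n) v S (k + 1)).card : ℝ) := by
        exact_mod_cast Finset.card_union_le _ _
    _ ≤ _ := add_le_add (card_cover_le hn S (by omega)) (card_zeros_exists_le hp v hS (k + 1))

/-- **Expansion failure**: for `v` with support `S`, if the combination has fewer than `W`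
non-zero coordinates then either at most `n - (a+1)` columns are covered or some `t` covered
columns vanish, provided `W + t ≤ n - a`. [Beck 2017, Lemma 5.2 (proof: coverage then
"the probability that any `4/p` fraction of these takes value zero")]
[cite: Beck2017, Lemma 5.2 (proof, expansion)] -/
theorem card_expansion_fail_le (hn : 0 < n) (hp : 2 ≤ p) (v : Fin m → ZMod p) {S : Finset (Fin m)}
    (hS : ∀ i, v i ≠ 0 ↔ i ∈ S) {a t : ℕ} (ha : a + 1 ≤ n) {W : ℝ} (hW : W + t ≤ (n : ℝ) - a) :
    ((expFail (n := n) d v W).card : ℝ) ≤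
      (n.choose (a + 1) : ℝ) * (Fintype.card (PickSpace m d n p) : ℝ) * ((((n - (a + 1) : ℕ) : ℝ)) / n) ^ (S.card * d) +
        (n.choose t : ℝ) * (Fintype.card (PickSpace m d n p) : ℝ) / ((p : ℝ) - 1) ^ t := by
  classical
  have hsub : expFail (n := n) d v W ⊆ coverFail (d := d) (n := n) (p := p) S (n - (a + 1)) ∪ zerosEvent v S t := by
    intro ω hω
    rw [mem_expFail] at hω
    rw [Finset.mem_union, mem_coverFail]
    by_cases hc : (covered ω S).card ≤ n - (a + 1)
    · exact Or.inl hc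
    · refine Or.inr (mem_zerosEvent_of_few_nonzero ω v S ?_)
      push Not at hc
      have h1 : (((univ.filter fun j => combVec ω v j ≠ 0).card + t : ℕ) : ℝ) < (n : ℝ) - a := by
        push_cast; linarith
      have h2 : ((univ.filter fun j => combVec ω v j ≠ 0).card + t : ℕ) < n - a := by
        have : ((n : ℝ) - a) = ((n - a : ℕ) : ℝ) := by rw [Nat.cast_sub (by omega)]
        rw [this] at h1
        exact_mod_cast h1
      omega
  calc ((expFail (n := n) d v W).card : ℝ)
      ≤ ((coverFail (d := d) (n := n) (p := p) S (n - (a + 1)) ∪ zerosEvent v S t).card : ℝ) := by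
        exact_mod_cast Finset.card_le_card hsub
    _ ≤ ((coverFail (d := d) (n := n) (p := p) S (n - (a + 1))).card : ℝ) + ((zerosEvent (d := d) (n := n) v S t).card : ℝ) := by
        exact_mod_cast Finset.card_union_le _ _
    _ ≤ _ := by
        refine add_le_add ?_ (card_zeros_exists_le hp v hS t)
        have := card_cover_le (m := m) (d := d) (p := p) hn S (Nat.sub_le n (a + 1))
        rwa [Nat.choose_symm ha] at this

/-! ### Analytic forms -/

/-- `C(n, r) (r/n)^{2r} ≤ (e r / n)^r`. [folklore] -/
theorem choose_mul_pow_le (hn : 0 < n) {r e₂ : ℕ} (hr : 1 ≤ r) (hrn : r ≤ n) (he : 2 * r ≤ e₂) :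
    (n.choose r : ℝ) * ((r : ℝ) / n) ^ e₂ ≤ (Real.exp 1 * r / n) ^ r := by
  have hrpos : (0 : ℝ) < r := by exact_mod_cast hr
  have hnpos : (0 : ℝ) < n := by exact_mod_cast hn
  have hq0 : (0 : ℝ) ≤ (r : ℝ) / n := by positivity
  have hq1 : (r : ℝ) / n ≤ 1 := by rw [div_le_one hnpos]; exact_mod_cast hrn
  calc (n.choose r : ℝ) * ((r : ℝ) / n) ^ e₂
      ≤ (Real.exp 1 * n / r) ^ r * ((r : ℝ) / n) ^ (2 * r) :=
        mul_le_mul (choose_le_epow n hr) (pow_le_pow_of_le_one hq0 hq1 he) (by positivity) (by positivity)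
    _ = (Real.exp 1 * r / n) ^ r := by
        rw [pow_mul, ← mul_pow]
        congr 1
        field_simp

end PerVector

end Literature.Computability.MetaComplexity

namespace Literature.Computability.MetaComplexity

open Finset Real

/-! ### Numerical facts -/

/-- `e ≤ 3`. [folklore] -/
theorem exp_one_le_three : Real.exp 1 ≤ 3 := le_of_lt Real.exp_one_lt_three

/-- `e² ≤ 8`, i.e. `e/8 ≤ e⁻¹`. [folklore] -/
theorem exp_one_sq_le_eight : Real.exp 1 ^ 2 ≤ 8 := by
  have := Real.exp_one_lt_d9
  nlinarith [Real.exp_pos 1]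

/-- `log p ≤ p/480` for `p ≥ 10⁴`. [folklore] -/
theorem log_le_div_480 {p : ℝ} (hp : (10 : ℝ) ^ 4 ≤ p) : Real.log p ≤ p / 480 := by
  have hppos : 0 < p := lt_of_lt_of_le (by norm_num) hp
  rw [Real.log_le_iff_le_exp hppos]
  refine le_trans ?_ (Real.pow_div_factorial_le_exp (p / 480) (by positivity) 8)
  rw [le_div_iff₀ (by positivity)]
  have h8 : (Nat.factorial 8 : ℝ) = 40320 := by norm_num [Nat.factorial]
  rw [h8]
  have h1 : p ^ 7 ≥ ((10 : ℝ) ^ 4) ^ 7 := by gcongr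
  have h2 : (40320 : ℝ) * 480 ^ 8 ≤ ((10 : ℝ) ^ 4) ^ 7 := by norm_num
  have h3 : (p / 480) ^ 8 = p ^ 8 / 480 ^ 8 := by rw [div_pow]
  rw [h3, le_div_iff₀ (by positivity)]
  nlinarith [pow_pos hppos 7]

/-- `9 ≤ log p` for `p ≥ 10⁴`. [folklore] -/
theorem nine_le_log {p : ℝ} (hp : (10 : ℝ) ^ 4 ≤ p) : 9 ≤ Real.log p := by
  have hppos : 0 < p := lt_of_lt_of_le (by norm_num) hp
  rw [Real.le_log_iff_exp_le hppos]
  calc Real.exp 9 = Real.exp 1 ^ 9 := by rw [Real.exp_one_pow]; norm_num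
    _ ≤ (2.7182818286 : ℝ) ^ 9 := by gcongr; exact le_of_lt Real.exp_one_lt_d9
    _ ≤ (10 : ℝ) ^ 4 := by norm_num
    _ ≤ p := hp

/-- `x ≤ e^{x-1}`. [folklore] -/
theorem le_exp_sub_one (x : ℝ) : x ≤ Real.exp (x - 1) := by
  have := Real.add_one_le_exp (x - 1); linarith

/-- `256 p³ ≤ 2^{d'}` for `d' ≥ 3p + 8` (from `p < 2^p`). [folklore] -/
theorem pow_three_le_two_pow {p d' : ℕ} (hd : 3 * p + 8 ≤ d') : (256 : ℝ) * (p : ℝ) ^ 3 ≤ 2 ^ d' := by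
  have h1 : (p : ℝ) < 2 ^ p := by exact_mod_cast Nat.lt_two_pow_self
  have h2 : (p : ℝ) ^ 3 ≤ (2 ^ p) ^ 3 := by
    gcongr
  calc (256 : ℝ) * (p : ℝ) ^ 3 ≤ 256 * (2 ^ p) ^ 3 := by gcongr
    _ = 2 ^ (3 * p + 8) := by rw [← pow_mul, pow_add]; norm_num; ring
    _ ≤ 2 ^ d' := pow_le_pow_right₀ (by norm_num) hd

/-! ### Regime 1: small supports -/

section Regime1

variable {n p : ℕ} [Fact p.Prime]

/-- The coefficient vectors with support of size `s`. [folklore] -/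
noncomputable def vecsOfCard (m : ℕ) (p : ℕ) [Fact p.Prime] (s : ℕ) : Finset (Fin m → ZMod p) :=
  univ.filter fun v => (vsupp v).card = s

/-- Membership in `vecsOfCard`. [folklore] -/
theorem mem_vecsOfCard {m s : ℕ} {v : Fin m → ZMod p} : v ∈ vecsOfCard m p s ↔ (vsupp v).card = s := by
  simp [vecsOfCard]

/-- The support of a coefficient vector, pointwise. [folklore] -/
theorem vsupp_spec {m : ℕ} (v : Fin m → ZMod p) : ∀ i, v i ≠ 0 ↔ i ∈ vsupp v := fun i => by
  simp [vsupp]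

/-- **Regime 1** (Beck 2017, Lemma 5.2, small sets): with `d = 2d'`, `d' ≥ 3p + 8`, the total
mass of the vanishing events over all vectors with support size `s ∈ [1, n/(8d')]` is at most
`|Ω|/7`. [cite: Beck2017, Lemma 5.2 (proof, small sets)] -/
theorem regime1_bound (hn : 1 ≤ n) {d' : ℕ} (hd' : 3 * p + 8 ≤ d') (hd'p2 : d' ≤ p ^ 2) :
    ∑ s ∈ Finset.Icc 1 (n / (8 * d')), ∑ v ∈ vecsOfCard (n + 1) p s,
        ((kernelEvent (2 * d') n v).card : ℝ) ≤
      (Fintype.card (PickSpace (n + 1) (2 * d') n p) : ℝ) / 7 := by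
  classical
  have hp2 := (Fact.out : p.Prime).two_le
  have hpR : (2 : ℝ) ≤ p := by exact_mod_cast hp2
  have hd'pos : 1 ≤ d' := by omega
  have hnpos : (0 : ℝ) < n := by exact_mod_cast hn
  set N := (Fintype.card (PickSpace (n + 1) (2 * d') n p) : ℝ) with hN
  have hNnn : 0 ≤ N := Nat.cast_nonneg _
  set β : ℝ := 2 * Real.exp 1 ^ 2 * ((p : ℝ) - 1) * d' * (Real.exp 1 / 8) ^ (d' - 1) with hβ
  -- `β ≤ 1/8`
  have hβle : β ≤ 1 / 8 := by
    have h1 : (Real.exp 1 / 8) ^ (d' - 1) ≤ (1 / 2) ^ (d' - 1) :=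
      pow_le_pow_left₀ (by positivity) (by linarith [exp_one_le_three]) _
    have h3 : (256 : ℝ) * (p : ℝ) ^ 3 ≤ 2 ^ d' := pow_three_le_two_pow hd'
    have hpow : (2 : ℝ) ^ d' = 2 ^ (d' - 1) * 2 := by rw [← pow_succ, Nat.sub_add_cancel hd'pos]
    have hpd : (p : ℝ) * d' ≤ (p : ℝ) ^ 3 := by
      have : (d' : ℝ) ≤ (p : ℝ) ^ 2 := by exact_mod_cast hd'p2
      nlinarith
    have hp0 : (0 : ℝ) ≤ (p : ℝ) - 1 := by linarith
    have hp1 : ((p : ℝ) - 1) ≤ p := by linarith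
    calc β ≤ 2 * 8 * (p : ℝ) * d' * (1 / 2) ^ (d' - 1) := by
          rw [hβ]
          gcongr
          exact exp_one_sq_le_eight
      _ = 32 * ((p : ℝ) * d') / 2 ^ d' := by rw [hpow, one_div_pow]; field_simp; ring
      _ ≤ 32 * (p : ℝ) ^ 3 / 2 ^ d' := by gcongr
      _ ≤ 1 / 8 := by rw [div_le_iff₀ (by positivity)]; linarith
  have hβnn : 0 ≤ β := by
    have hp0 : (0 : ℝ) ≤ (p : ℝ) - 1 := by linarith
    rw [hβ]
    exact mul_nonneg (mul_nonneg (mul_nonneg (mul_nonneg (by norm_num) (pow_nonneg (Real.exp_pos 1).le 2))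
      hp0) (Nat.cast_nonneg d')) (pow_nonneg (by positivity) _)
  -- per `s`
  have hterm : ∀ s ∈ Finset.Icc 1 (n / (8 * d')),
      ∑ v ∈ vecsOfCard (n + 1) p s, ((kernelEvent (2 * d') n v).card : ℝ) ≤ β ^ s * N := by
    intro s hs
    obtain ⟨hs1, hs0⟩ := Finset.mem_Icc.1 hs
    have h8 : 8 * (s * d') ≤ n := by
      have := Nat.div_mul_le_self n (8 * d')
      nlinarith
    have hsd'n : s * d' ≤ n := by omega
    have hsd'1 : 1 ≤ s * d' := Nat.one_le_iff_ne_zero.2 (by positivity)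
    -- each vector: the small-regime bound
    have hv : ∀ v ∈ vecsOfCard (n + 1) p s, ((kernelEvent (2 * d') n v).card : ℝ) ≤
        (n.choose (s * d') : ℝ) * N * (((s * d' : ℕ) : ℝ) / n) ^ (s * (2 * d')) := by
      intro v hv
      have hcard := mem_vecsOfCard.1 hv
      have := card_kernel_small_le (m := n + 1) (n := n) (p := p) (d' := d') (by omega) v (vsupp_spec v) (by
        rw [hcard]
        have : 4 * (s * (2 * d')) = 8 * (s * d') := by ring
        omega)
      rwa [hcard] at this
    calc ∑ v ∈ vecsOfCard (n + 1) p s, ((kernelEvent (2 * d') n v).card : ℝ)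
        ≤ ∑ v ∈ vecsOfCard (n + 1) p s, (n.choose (s * d') : ℝ) * N * (((s * d' : ℕ) : ℝ) / n) ^ (s * (2 * d')) :=
          Finset.sum_le_sum hv
      _ = ((vecsOfCard (n + 1) p s).card : ℝ) * ((n.choose (s * d') : ℝ) * (((s * d' : ℕ) : ℝ) / n) ^ (s * (2 * d')) * N) := by
          rw [Finset.sum_const, nsmul_eq_mul]; ring
      _ ≤ (((n + 1).choose s : ℝ) * ((p : ℝ) - 1) ^ s) * ((Real.exp 1 * (s * d' : ℕ) / n) ^ (s * d') * N) := by
          have hp0 : (0 : ℝ) ≤ (p : ℝ) - 1 := by linarith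
          apply mul_le_mul (card_vsupp_card_eq_le (m := n + 1) s) _ (by positivity)
            (mul_nonneg (Nat.cast_nonneg _) (pow_nonneg hp0 s))
          apply mul_le_mul_of_nonneg_right _ hNnn
          exact choose_mul_pow_le (by omega) hsd'1 hsd'n (by nlinarith)
      _ ≤ ((Real.exp 1 * (n + 1 : ℕ) / s) ^ s * ((p : ℝ) - 1) ^ s) * ((Real.exp 1 * (s * d' : ℕ) / n) ^ (s * d') * N) := by
          have hp0 : (0 : ℝ) ≤ (p : ℝ) - 1 := by linarith
          exact mul_le_mul_of_nonneg_right (mul_le_mul_of_nonneg_right (choose_le_epow (n + 1) hs1)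
            (pow_nonneg hp0 s)) (by positivity)
      _ = ((Real.exp 1 * (n + 1 : ℕ) * ((p : ℝ) - 1) / s) * (Real.exp 1 * (s * d' : ℕ) / n) ^ d') ^ s * N := by
          generalize ((p : ℝ) - 1) = q
          rw [mul_pow (Real.exp 1 * (n + 1 : ℕ) * q / s), ← pow_mul, mul_comm d' s, pow_mul]
          ring
      _ ≤ β ^ s * N := by
          apply mul_le_mul_of_nonneg_right _ hNnn
          have hp0 : (0 : ℝ) ≤ (p : ℝ) - 1 := by linarith
          apply pow_le_pow_left₀ (mul_nonneg (div_nonneg (mul_nonneg (by positivity) hp0) (Nat.cast_nonneg s))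
            (by positivity))
          -- the bracket is at most `β`
          have hsR : (0 : ℝ) < s := by exact_mod_cast hs1
          have hq : Real.exp 1 * (s * d' : ℕ) / n ≤ Real.exp 1 / 8 := by
            rw [div_le_div_iff₀ hnpos (by norm_num)]
            have : ((s * d' : ℕ) : ℝ) * 8 ≤ n := by exact_mod_cast (by omega : s * d' * 8 ≤ n)
            nlinarith [Real.exp_pos 1]
          have hq0 : 0 ≤ Real.exp 1 * (s * d' : ℕ) / n := by positivity
          calc Real.exp 1 * (n + 1 : ℕ) * ((p : ℝ) - 1) / s * (Real.exp 1 * (s * d' : ℕ) / n) ^ d'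
              = Real.exp 1 * (n + 1 : ℕ) * ((p : ℝ) - 1) / s * ((Real.exp 1 * (s * d' : ℕ) / n) *
                  (Real.exp 1 * (s * d' : ℕ) / n) ^ (d' - 1)) := by
                  rw [← pow_succ', Nat.sub_add_cancel hd'pos]
            _ = (Real.exp 1 ^ 2 * ((p : ℝ) - 1) * d' * (((n + 1 : ℕ) : ℝ) / n)) *
                  (Real.exp 1 * (s * d' : ℕ) / n) ^ (d' - 1) := by
                  push_cast; field_simp
            _ ≤ (Real.exp 1 ^ 2 * ((p : ℝ) - 1) * d' * 2) * (Real.exp 1 / 8) ^ (d' - 1) := by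
                  have hmn : (((n + 1 : ℕ) : ℝ) / n) ≤ 2 := by
                    rw [div_le_iff₀ hnpos]; push_cast; linarith [show (1:ℝ) ≤ n by exact_mod_cast hn]
                  have : (0:ℝ) ≤ (p:ℝ) - 1 := by linarith
                  gcongr
            _ = β := by rw [hβ]; ring
  -- sum the geometric series
  calc ∑ s ∈ Finset.Icc 1 (n / (8 * d')), ∑ v ∈ vecsOfCard (n + 1) p s, ((kernelEvent (2 * d') n v).card : ℝ)
      ≤ ∑ s ∈ Finset.Icc 1 (n / (8 * d')), β ^ s * N := Finset.sum_le_sum hterm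
    _ ≤ ∑ s ∈ Finset.Icc 1 (n / (8 * d')), (1 / 8 : ℝ) ^ s * N :=
        Finset.sum_le_sum fun s _ => mul_le_mul_of_nonneg_right (pow_le_pow_left₀ hβnn hβle s) hNnn
    _ = (∑ s ∈ Finset.Ico 1 (n / (8 * d') + 1), (1 / 8 : ℝ) ^ s) * N := by
        rw [Finset.sum_mul]; rfl
    _ ≤ ((1 / 8 : ℝ) ^ 1 / (1 - 1 / 8)) * N :=
        mul_le_mul_of_nonneg_right (geom_sum_Ico_le_of_lt_one (by norm_num) (by norm_num)) hNnn
    _ = N / 7 := by ring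

end Regime1

/-! ### Regime 2: large supports, vanishing combination -/

section Regime2

variable {n p : ℕ} [Fact p.Prime]

/-- `exp 7 ≥ 1096`. [folklore] -/
theorem exp_seven_ge : (1096 : ℝ) ≤ Real.exp 7 := by
  calc (1096 : ℝ) ≤ (2.7182818283 : ℝ) ^ 7 := by norm_num
    _ ≤ Real.exp 1 ^ 7 := by gcongr; exact le_of_lt Real.exp_one_gt_d9
    _ = Real.exp 7 := by rw [Real.exp_one_pow]; norm_num

/-- `exp 9 ≥ 8000`. [folklore] -/
theorem exp_nine_ge : (8000 : ℝ) ≤ Real.exp 9 := by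
  calc (8000 : ℝ) ≤ (2.7182818283 : ℝ) ^ 9 := by norm_num
    _ ≤ Real.exp 1 ^ 9 := by gcongr; exact le_of_lt Real.exp_one_gt_d9
    _ = Real.exp 9 := by rw [Real.exp_one_pow]; norm_num

/-- Regime 2, per vector: for support size `s` with `8 s d' > n`, the vanishing event has
mass at most `2 (e/8)^{n/8} |Ω|`. [Beck 2017, Lemma 5.2 (proof, large sets)]
[cite: Beck2017, Lemma 5.2 (proof, large sets)] -/
theorem regime2_perVector (hn : 100 ≤ n) (hp66 : 66 ≤ p) {d' : ℕ} {s : ℕ}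
    (hs : n < 8 * (s * d')) (v : Fin (n + 1) → ZMod p) (hv : (vsupp v).card = s) :
    ((kernelEvent (2 * d') n v).card : ℝ) ≤
      2 * (Real.exp 1 / 8) ^ (n / 8) * (Fintype.card (PickSpace (n + 1) (2 * d') n p) : ℝ) := by
  classical
  have hp2 := (Fact.out : p.Prime).two_le
  have hpR : (66 : ℝ) ≤ p := by exact_mod_cast hp66
  have hnpos : (0 : ℝ) < n := by exact_mod_cast (show 0 < n by omega)
  set N := (Fintype.card (PickSpace (n + 1) (2 * d') n p) : ℝ) with hN
  have hNnn : 0 ≤ N := Nat.cast_nonneg _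
  set k := n / 8 with hk
  have hk8 : 8 * k ≤ n := Nat.mul_div_le n 8
  have hk8' : n < 8 * (k + 1) := by omega
  have hk1 : 1 ≤ k := by omega
  have hsd : 2 * k ≤ s * (2 * d') := by nlinarith
  have h := card_kernel_large_le (m := n + 1) (n := n) (p := p) (d := 2 * d') (by omega) hp2 v
    (vsupp_spec v) (k := k) (by omega)
  rw [hv] at h
  refine h.trans ?_
  have hkn : k ≤ n := by omega
  have t1 : (n.choose k : ℝ) * N * ((k : ℝ) / n) ^ (s * (2 * d')) ≤ (Real.exp 1 / 8) ^ k * N := by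
    have := choose_mul_pow_le (n := n) (by omega) hk1 hkn hsd
    calc (n.choose k : ℝ) * N * ((k : ℝ) / n) ^ (s * (2 * d'))
        = ((n.choose k : ℝ) * ((k : ℝ) / n) ^ (s * (2 * d'))) * N := by ring
      _ ≤ (Real.exp 1 * k / n) ^ k * N := mul_le_mul_of_nonneg_right this hNnn
      _ ≤ (Real.exp 1 / 8) ^ k * N := by
          apply mul_le_mul_of_nonneg_right _ hNnn
          apply pow_le_pow_left₀ (by positivity)
          rw [div_le_div_iff₀ hnpos (by norm_num)]
          have : (k : ℝ) * 8 ≤ n := by exact_mod_cast (by omega : k * 8 ≤ n)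
          nlinarith [Real.exp_pos 1]
  have t2 : (n.choose (k + 1) : ℝ) * N / ((p : ℝ) - 1) ^ (k + 1) ≤ (Real.exp 1 / 8) ^ k * N := by
    have hp1 : (0 : ℝ) < (p : ℝ) - 1 := by linarith
    rw [div_le_iff₀ (pow_pos hp1 _)]
    have hc : (n.choose (k + 1) : ℝ) ≤ (Real.exp 1 * n / (k + 1 : ℕ)) ^ (k + 1) := choose_le_epow n (by omega)
    have hq : Real.exp 1 * n / (k + 1 : ℕ) ≤ (Real.exp 1 / 8) * ((p : ℝ) - 1) := by
      have hk1R : (0 : ℝ) < (k + 1 : ℕ) := by positivity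
      rw [div_le_iff₀ hk1R]
      have h8k : (n : ℝ) ≤ 8 * (k + 1 : ℕ) := by exact_mod_cast hk8'.le
      have h65 : (65 : ℝ) ≤ (p : ℝ) - 1 := by linarith
      have hepos := Real.exp_pos 1
      calc Real.exp 1 * n ≤ Real.exp 1 * (8 * (k + 1 : ℕ)) := mul_le_mul_of_nonneg_left h8k hepos.le
        _ = (Real.exp 1 / 8) * 64 * (k + 1 : ℕ) := by ring
        _ ≤ (Real.exp 1 / 8) * ((p : ℝ) - 1) * (k + 1 : ℕ) := by
            apply mul_le_mul_of_nonneg_right _ hk1R.le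
            apply mul_le_mul_of_nonneg_left _ (by positivity)
            linarith
    calc (n.choose (k + 1) : ℝ) * N ≤ (Real.exp 1 * n / (k + 1 : ℕ)) ^ (k + 1) * N :=
          mul_le_mul_of_nonneg_right hc hNnn
      _ ≤ ((Real.exp 1 / 8) * ((p : ℝ) - 1)) ^ (k + 1) * N := by
          apply mul_le_mul_of_nonneg_right _ hNnn
          exact pow_le_pow_left₀ (by positivity) hq _
      _ = (Real.exp 1 / 8) ^ (k + 1) * N * ((p : ℝ) - 1) ^ (k + 1) := by rw [mul_pow]; ring
      _ ≤ (Real.exp 1 / 8) ^ k * N * ((p : ℝ) - 1) ^ (k + 1) := by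
          apply mul_le_mul_of_nonneg_right _ (pow_nonneg hp1.le _)
          apply mul_le_mul_of_nonneg_right _ hNnn
          exact pow_le_pow_of_le_one (by positivity) (by linarith [exp_one_le_three]) (Nat.le_succ k)
  linarith

/-- Regime 2, the number of coefficient vectors of support size `s` with `8 s d' > n`:
at most `(16 e d' p)^s`. [folklore] -/
theorem regime2_cardV {d' s : ℕ} (hs0 : 1 ≤ s) (hs : n < 8 * (s * d')) :
    ((vecsOfCard (n + 1) p s).card : ℝ) ≤ (16 * Real.exp 1 * d' * p) ^ s := by
  have hp2 := (Fact.out : p.Prime).two_le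
  have hpR : (2 : ℝ) ≤ p := by exact_mod_cast hp2
  have hp0 : (0 : ℝ) ≤ (p : ℝ) - 1 := by linarith
  calc ((vecsOfCard (n + 1) p s).card : ℝ) ≤ ((n + 1).choose s : ℝ) * ((p : ℝ) - 1) ^ s :=
        card_vsupp_card_eq_le (m := n + 1) s
    _ ≤ (Real.exp 1 * (n + 1 : ℕ) / s) ^ s * ((p : ℝ) - 1) ^ s :=
        mul_le_mul_of_nonneg_right (choose_le_epow _ hs0) (pow_nonneg hp0 s)
    _ = (Real.exp 1 * (n + 1 : ℕ) / s * ((p : ℝ) - 1)) ^ s := by rw [mul_pow]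
    _ ≤ (16 * Real.exp 1 * d' * p) ^ s := by
        apply pow_le_pow_left₀ (mul_nonneg (by positivity) hp0)
        have hsR : (0 : ℝ) < s := by exact_mod_cast hs0
        have h1 : Real.exp 1 * (n + 1 : ℕ) / s ≤ 16 * Real.exp 1 * d' := by
          rw [div_le_iff₀ hsR]
          have hn8 : (n : ℝ) < 8 * ((s : ℝ) * d') := by exact_mod_cast hs
          have hsd : (1 : ℝ) ≤ (s : ℝ) * d' := by exact_mod_cast (show 1 ≤ s * d' by nlinarith)
          have hepos := Real.exp_pos 1
          have : ((n + 1 : ℕ) : ℝ) ≤ 16 * ((s : ℝ) * d') := by push_cast; linarith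
          calc Real.exp 1 * (n + 1 : ℕ) ≤ Real.exp 1 * (16 * ((s : ℝ) * d')) :=
                mul_le_mul_of_nonneg_left this hepos.le
            _ = 16 * Real.exp 1 * d' * s := by ring
        have h2 : ((p : ℝ) - 1) ≤ p := by linarith
        calc Real.exp 1 * (n + 1 : ℕ) / s * ((p : ℝ) - 1) ≤ (16 * Real.exp 1 * d') * p :=
              mul_le_mul h1 h2 hp0 (by positivity)
          _ = 16 * Real.exp 1 * d' * p := by ring

omit [Fact p.Prime] in
/-- Regime 2, numerics: `R · X^R · 2 (e/8)^k ≤ 1/8` for `R ≤ 3n/p`, `X = 16 e d' p ≤ p⁴`,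
`k > n/8 - 1`, `p ≥ 10⁴`, `n ≥ 100`. [folklore] -/
theorem regime2_numeric (hn : 100 ≤ n) (hp : 10 ^ 4 ≤ p) {d' : ℕ} (hd'1 : 1 ≤ d') (hd'p2 : 2 * d' ≤ p ^ 2) :
    ((3 * n / p : ℕ) : ℝ) * ((16 * Real.exp 1 * d' * p) ^ (3 * n / p) * (2 * (Real.exp 1 / 8) ^ (n / 8))) ≤ 1 / 8 := by
  have hpR : (10 : ℝ) ^ 4 ≤ p := by exact_mod_cast hp
  have hnR : (100 : ℝ) ≤ n := by exact_mod_cast hn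
  have hppos : (0 : ℝ) < p := by linarith
  set k := n / 8 with hk
  have hk8' : n < 8 * (k + 1) := by omega
  have hkR : (n : ℝ) / 8 - 1 ≤ k := by
    have : (n : ℝ) < 8 * ((k : ℝ) + 1) := by exact_mod_cast hk8'
    linarith
  set X : ℝ := 16 * Real.exp 1 * d' * p with hX
  have hX1 : 1 ≤ X := by
    rw [hX]
    have h1 : (1 : ℝ) ≤ d' := by exact_mod_cast hd'1
    have h2 : (2 : ℝ) ≤ Real.exp 1 := by linarith [Real.add_one_le_exp (1 : ℝ)]
    have : (1 : ℝ) ≤ Real.exp 1 * d' := by nlinarith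
    nlinarith
  have hXpos : 0 < X := by linarith
  set R := 3 * n / p with hR
  have hRle : (R : ℝ) ≤ 3 * n / p := by
    have := Nat.cast_div_le (α := ℝ) (m := 3 * n) (n := p)
    push_cast at this
    exact this
  have hlogp : Real.log p ≤ p / 480 := log_le_div_480 hpR
  have hY : Real.exp 1 / 8 ≤ Real.exp (-1) := by
    rw [div_le_iff₀ (by norm_num : (0:ℝ) < 8), Real.exp_neg, inv_mul_eq_div, le_div_iff₀ (Real.exp_pos 1)]
    nlinarith [exp_one_sq_le_eight]
  -- `X^R ≤ exp (n/40)`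
  have hXR : X ^ R ≤ Real.exp (n / 40) := by
    rw [← Real.exp_log (pow_pos hXpos R), Real.exp_le_exp, Real.log_pow]
    have hlogX : Real.log X ≤ 4 * Real.log p := by
      have hd'R : (d' : ℝ) ≤ (p : ℝ) ^ 2 := by
        have : ((2 * d' : ℕ) : ℝ) ≤ ((p ^ 2 : ℕ) : ℝ) := by exact_mod_cast hd'p2
        push_cast at this; linarith [show (0:ℝ) ≤ d' from Nat.cast_nonneg d']
      have hXle : X ≤ (p : ℝ) ^ 4 := by
        have h48 : (48 : ℝ) ≤ p := by linarith
        calc X = 16 * Real.exp 1 * d' * p := hX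
          _ ≤ 16 * 3 * (p : ℝ) ^ 2 * p := by gcongr; exact exp_one_le_three
          _ = 48 * (p : ℝ) ^ 3 := by ring
          _ ≤ p * (p : ℝ) ^ 3 := mul_le_mul_of_nonneg_right h48 (by positivity)
          _ = (p : ℝ) ^ 4 := by ring
      calc Real.log X ≤ Real.log ((p : ℝ) ^ 4) := Real.log_le_log hXpos hXle
        _ = 4 * Real.log p := by rw [Real.log_pow]; norm_num
    calc (R : ℝ) * Real.log X ≤ (3 * n / p) * (4 * Real.log p) :=
          mul_le_mul hRle hlogX (Real.log_nonneg hX1) (by positivity)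
      _ = 12 * n * (Real.log p / p) := by ring
      _ ≤ 12 * n * (1 / 480) := by
          apply mul_le_mul_of_nonneg_left _ (by positivity)
          rw [div_le_div_iff₀ hppos (by norm_num)]; linarith
      _ = n / 40 := by ring
  have hYk : (Real.exp 1 / 8) ^ k ≤ Real.exp (1 - n / 8) := by
    calc (Real.exp 1 / 8) ^ k ≤ Real.exp (-1) ^ k := pow_le_pow_left₀ (by positivity) hY k
      _ = Real.exp (-k) := by rw [← Real.exp_nat_mul]; ring_nf
      _ ≤ Real.exp (1 - n / 8) := Real.exp_le_exp.2 (by linarith)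
  have hRn : (R : ℝ) ≤ 40 * Real.exp (n / 40 - 1) := by
    have h1 : (R : ℝ) ≤ n := by
      refine hRle.trans ?_
      rw [div_le_iff₀ hppos]; nlinarith
    have h2 : (n : ℝ) / 40 ≤ Real.exp (n / 40 - 1) := le_exp_sub_one _
    linarith
  have hprod : Real.exp (n / 40 - 1) * (Real.exp (n / 40) * Real.exp (1 - n / 8)) = Real.exp (-(3 * n / 40)) := by
    rw [← Real.exp_add, ← Real.exp_add]; congr 1; ring
  calc (R : ℝ) * (X ^ R * (2 * (Real.exp 1 / 8) ^ k))
      ≤ (40 * Real.exp (n / 40 - 1)) * (Real.exp (n / 40) * (2 * Real.exp (1 - n / 8))) :=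
        mul_le_mul hRn (mul_le_mul hXR (by linarith) (by positivity) (Real.exp_pos _).le)
          (by positivity) (by positivity)
    _ = 80 * Real.exp (-(3 * n / 40)) := by rw [← hprod]; ring
    _ ≤ 80 * Real.exp (-7) := by gcongr; linarith
    _ ≤ 1 / 8 := by
        rw [Real.exp_neg, mul_inv_le_iff₀ (Real.exp_pos 7)]
        linarith [exp_seven_ge]

/-- **Regime 2** (Beck 2017, Lemma 5.2, large sets with zero image): for `p ≥ 10⁴`,
`2 ≤ d = 2d' ≤ p²` and `n ≥ 100`, the total mass of the vanishing events over all vectors with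
support size `s ∈ (n/(8d'), 3n/p]` is at most `|Ω|/8`.
[cite: Beck2017, Lemma 5.2 (proof, large sets)] -/
theorem regime2_bound (hn : 100 ≤ n) (hp : 10 ^ 4 ≤ p) {d' : ℕ} (hd'1 : 1 ≤ d') (hd'p2 : 2 * d' ≤ p ^ 2) :
    ∑ s ∈ Finset.Icc (n / (8 * d') + 1) (3 * n / p), ∑ v ∈ vecsOfCard (n + 1) p s,
        ((kernelEvent (2 * d') n v).card : ℝ) ≤
      (Fintype.card (PickSpace (n + 1) (2 * d') n p) : ℝ) / 8 := by
  set N := (Fintype.card (PickSpace (n + 1) (2 * d') n p) : ℝ) with hN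
  have hNnn : 0 ≤ N := Nat.cast_nonneg _
  set X : ℝ := 16 * Real.exp 1 * d' * p with hX
  have hX1 : 1 ≤ X := by
    rw [hX]
    have h1 : (1 : ℝ) ≤ d' := by exact_mod_cast hd'1
    have h2 : (2 : ℝ) ≤ Real.exp 1 := by linarith [Real.add_one_le_exp (1 : ℝ)]
    have h3 : (2 : ℝ) ≤ p := by exact_mod_cast (Fact.out : p.Prime).two_le
    have : (1 : ℝ) ≤ Real.exp 1 * d' := by nlinarith
    nlinarith
  set R := 3 * n / p with hR
  set Y : ℝ := 2 * (Real.exp 1 / 8) ^ (n / 8) with hY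
  have hYnn : 0 ≤ Y := by positivity
  have hrange : ∀ s ∈ Finset.Icc (n / (8 * d') + 1) R, 1 ≤ s ∧ n < 8 * (s * d') := by
    intro s hs
    obtain ⟨hs1, -⟩ := Finset.mem_Icc.1 hs
    refine ⟨le_trans (Nat.le_add_left 1 _) hs1, ?_⟩
    have := Nat.lt_div_mul_add (a := n) (show 0 < 8 * d' by omega)
    calc n < n / (8 * d') * (8 * d') + 8 * d' := this
      _ = 8 * ((n / (8 * d') + 1) * d') := by ring
      _ ≤ 8 * (s * d') := by nlinarith
  calc ∑ s ∈ Finset.Icc (n / (8 * d') + 1) R, ∑ v ∈ vecsOfCard (n + 1) p s, ((kernelEvent (2 * d') n v).card : ℝ)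
      ≤ ∑ s ∈ Finset.Icc (n / (8 * d') + 1) R, X ^ R * (Y * N) := by
        refine Finset.sum_le_sum fun s hs => ?_
        obtain ⟨hs0, hs8⟩ := hrange s hs
        calc ∑ v ∈ vecsOfCard (n + 1) p s, ((kernelEvent (2 * d') n v).card : ℝ)
            ≤ ∑ v ∈ vecsOfCard (n + 1) p s, Y * N :=
              Finset.sum_le_sum fun v hv => regime2_perVector hn (by omega) hs8 v (mem_vecsOfCard.1 hv)
          _ = ((vecsOfCard (n + 1) p s).card : ℝ) * (Y * N) := by rw [Finset.sum_const, nsmul_eq_mul]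
          _ ≤ X ^ s * (Y * N) := mul_le_mul_of_nonneg_right (regime2_cardV hs0 hs8) (by positivity)
          _ ≤ X ^ R * (Y * N) := by
              apply mul_le_mul_of_nonneg_right _ (by positivity)
              exact pow_le_pow_right₀ hX1 (Finset.mem_Icc.1 hs).2
    _ = ((Finset.Icc (n / (8 * d') + 1) R).card : ℝ) * (X ^ R * (Y * N)) := by rw [Finset.sum_const, nsmul_eq_mul]
    _ ≤ R * (X ^ R * (Y * N)) := by
        apply mul_le_mul_of_nonneg_right _ (by positivity)
        have : (Finset.Icc (n / (8 * d') + 1) R).card ≤ R := by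
          have h0 := Nat.zero_le (n / (8 * d'))
          have hR0 := Nat.zero_le R
          rw [Nat.card_Icc]; omega
        exact_mod_cast this
    _ = (R * (X ^ R * Y)) * N := by ring
    _ ≤ 1 / 8 * N := mul_le_mul_of_nonneg_right (regime2_numeric hn hp hd'1 hd'p2) hNnn
    _ = N / 8 := by ring

end Regime2

/-! ### Regime 3: the expansion range -/

section Regime3

variable {n p : ℕ} [Fact p.Prime]

/-- The loss `θ(p) = (2 + 15 log p)/p` of the construction. [Bonacina 2017, Prop. 8.1
(`θ = Õ(1/p)`)] [folklore] -/
noncomputable def thetaOf (p : ℕ) : ℝ := (2 + 15 * Real.log p) / p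

/-- The number `t(n,p) = ⌊15 n log p / p⌋ + 1` of vanishing columns that is already too
unlikely. [Beck 2017, Lemma 5.2 (proof)] [folklore] -/
noncomputable def tOf (n p : ℕ) : ℕ := ⌊15 * n * Real.log p / p⌋₊ + 1

omit [Fact p.Prime] in
/-- `t(n,p) ≥ 1`. [folklore] -/
theorem one_le_tOf : 1 ≤ tOf n p := Nat.succ_le_succ (Nat.zero_le _)

omit [Fact p.Prime] in
/-- Regime 3, the coverage term: `C(n, a+1) (1 - (a+1)/n)^{s·2d'} ≤ exp((n/p+2)(1+log p) - n/2)`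
for `a = ⌊n/p⌋ + 1`, `s ≥ n/p`, `4d' ≥ p²`. [Beck 2017, Lemma 5.2 (proof, coverage)] [folklore] -/
theorem regime3_covTerm (hp : 10 ^ 4 ≤ p) (hn3 : 3 * p ≤ n) {d' : ℕ} (hd'4 : p ^ 2 ≤ 4 * d') {s : ℕ}
    (hsR : (n : ℝ) / p ≤ s) :
    (n.choose (n / p + 1 + 1) : ℝ) * ((((n - (n / p + 1 + 1) : ℕ) : ℝ)) / n) ^ (s * (2 * d')) ≤
      Real.exp ((n / p + 2) * (1 + Real.log p) - n / 2) := by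
  have hpR : (10 : ℝ) ^ 4 ≤ p := by exact_mod_cast hp
  have hppos : (0 : ℝ) < p := by linarith
  have hpnat : 0 < p := by exact_mod_cast hppos
  have hnR : 3 * (p : ℝ) ≤ n := by exact_mod_cast hn3
  have hnpos : (0 : ℝ) < n := by linarith
  set a := n / p + 1 with ha
  have ha1 : (n : ℝ) / p ≤ (a : ℝ) := by
    have h := Nat.lt_div_mul_add (a := n) hpnat
    have : (n : ℝ) < ((n / p : ℕ) : ℝ) * p + p := by exact_mod_cast h
    rw [ha]; push_cast
    rw [div_le_iff₀ hppos]; linarith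
  have ha2 : (a : ℝ) + 1 ≤ n / p + 2 := by
    rw [ha]; push_cast
    have := Nat.cast_div_le (α := ℝ) (m := n) (n := p)
    linarith
  have han : a + 1 ≤ n := by
    have h1 : n / p ≤ n / 3 := Nat.div_le_div_left (by omega) (by norm_num)
    have h0 := Nat.zero_le (n / p)
    rw [ha]; omega
  have hx0 : 0 ≤ ((a : ℝ) + 1) / n := by positivity
  have hx1 : ((a : ℝ) + 1) / n ≤ 1 := by
    rw [div_le_one hnpos]; exact_mod_cast han
  have hcast : (((n - (a + 1) : ℕ) : ℝ)) / n = 1 - ((a : ℝ) + 1) / n := by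
    rw [Nat.cast_sub han]; push_cast; field_simp
  have hpow : ((((n - (a + 1) : ℕ) : ℝ)) / n) ^ (s * (2 * d')) ≤ Real.exp (-(n / 2)) := by
    rw [hcast]
    refine (one_sub_pow_le_exp hx1 _).trans (Real.exp_le_exp.2 ?_)
    have hd'R : (p : ℝ) ^ 2 ≤ 4 * d' := by exact_mod_cast hd'4
    have h1 : (1 : ℝ) / p ≤ ((a : ℝ) + 1) / n := by
      rw [div_le_div_iff₀ hppos hnpos]
      have : (n : ℝ) / p ≤ (a : ℝ) + 1 := by linarith
      rw [div_le_iff₀ hppos] at this; linarith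
    have h2 : ((s * (2 * d') : ℕ) : ℝ) = s * (2 * d') := by push_cast; ring
    rw [h2]
    have h3 : (1 : ℝ) / p * ((n / p) * (2 * d')) ≤ ((a : ℝ) + 1) / n * (s * (2 * d')) :=
      mul_le_mul h1 (mul_le_mul_of_nonneg_right hsR (by positivity)) (by positivity) hx0
    have h4 : (n : ℝ) / 2 ≤ (1 : ℝ) / p * ((n / p) * (2 * d')) := by
      rw [show (1 : ℝ) / p * ((n / p) * (2 * d')) = n * (2 * d') / (p * p) by field_simp]
      rw [div_le_div_iff₀ (by norm_num) (by positivity)]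
      nlinarith
    linarith
  have hchoose : (n.choose (a + 1) : ℝ) ≤ Real.exp ((n / p + 2) * (1 + Real.log p)) := by
    have hc := choose_le_epow n (Nat.le_add_left 1 a)
    refine hc.trans ?_
    have hbase : Real.exp 1 * n / (a + 1 : ℕ) ≤ Real.exp 1 * p := by
      have ha0 : (0 : ℝ) < (a + 1 : ℕ) := by positivity
      rw [div_le_iff₀ ha0]
      have : (n : ℝ) ≤ p * (a + 1 : ℕ) := by
        push_cast
        rw [div_le_iff₀ hppos] at ha1; nlinarith
      nlinarith [Real.exp_pos 1]
    calc (Real.exp 1 * n / (a + 1 : ℕ)) ^ (a + 1) ≤ (Real.exp 1 * p) ^ (a + 1) :=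
          pow_le_pow_left₀ (by positivity) hbase _
      _ = Real.exp ((a + 1 : ℕ) * (1 + Real.log p)) := by
          rw [← Real.exp_log (by positivity : 0 < Real.exp 1 * p), ← Real.exp_nat_mul,
            Real.log_mul (Real.exp_pos 1).ne' hppos.ne', Real.log_exp]
      _ ≤ Real.exp ((n / p + 2) * (1 + Real.log p)) := by
          rw [Real.exp_le_exp]
          push_cast
          exact mul_le_mul_of_nonneg_right ha2 (by linarith [nine_le_log hpR])
  calc (n.choose (a + 1) : ℝ) * ((((n - (a + 1) : ℕ) : ℝ)) / n) ^ (s * (2 * d'))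
      ≤ Real.exp ((n / p + 2) * (1 + Real.log p)) * Real.exp (-(n / 2)) :=
        mul_le_mul hchoose hpow (by positivity) (Real.exp_pos _).le
    _ = Real.exp ((n / p + 2) * (1 + Real.log p) - n / 2) := by rw [← Real.exp_add]; ring_nf

omit [Fact p.Prime] in
/-- Regime 3, the vanishing term: `C(n,t) (p-1)^{-t} ≤ exp(-41 n log p / p)` for
`t = ⌊15 n log p/p⌋ + 1`, `p ≥ 10⁴`. [Beck 2017, Lemma 5.2 (proof, zeros)] [folklore] -/
theorem regime3_zeroTerm (hp : 10 ^ 4 ≤ p) (hn : 0 < n) :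
    (n.choose (tOf n p) : ℝ) / ((p : ℝ) - 1) ^ (tOf n p) ≤ Real.exp (-(41 * n * Real.log p / p)) := by
  have hpR : (10 : ℝ) ^ 4 ≤ p := by exact_mod_cast hp
  have hppos : (0 : ℝ) < p := by linarith
  have hnpos : (0 : ℝ) < n := by exact_mod_cast hn
  have hlogp9 : 9 ≤ Real.log p := nine_le_log hpR
  have hp1 : (0 : ℝ) < (p : ℝ) - 1 := by linarith
  have ht1 : 15 * n * Real.log p / p ≤ tOf n p := by
    rw [tOf]; push_cast; exact (Nat.lt_floor_add_one _).le
  have htpos : (0 : ℝ) < tOf n p := by exact_mod_cast one_le_tOf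
  rw [div_le_iff₀ (pow_pos hp1 _)]
  have hc := choose_le_epow n (one_le_tOf (n := n) (p := p))
  have hbase : Real.exp 1 * n / tOf n p ≤ (1 / 20) * ((p : ℝ) - 1) := by
    rw [div_le_iff₀ htpos]
    have h3 : (1 : ℝ) / 2 ≤ ((p : ℝ) - 1) / p := by
      rw [div_le_div_iff₀ (by norm_num) hppos]; linarith
    have h4 : Real.exp 1 * 20 ≤ 15 * Real.log p * (1 / 2) := by nlinarith [exp_one_le_three]
    have h5 : Real.exp 1 * n * 20 ≤ 15 * n * Real.log p / p * ((p : ℝ) - 1) := by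
      rw [show 15 * n * Real.log p / p * ((p : ℝ) - 1) = n * (15 * Real.log p * (((p:ℝ) - 1) / p)) by
        field_simp]
      calc Real.exp 1 * n * 20 = n * (Real.exp 1 * 20) := by ring
        _ ≤ n * (15 * Real.log p * (1 / 2)) := mul_le_mul_of_nonneg_left h4 hnpos.le
        _ ≤ n * (15 * Real.log p * (((p : ℝ) - 1) / p)) := by
            apply mul_le_mul_of_nonneg_left _ hnpos.le
            exact mul_le_mul_of_nonneg_left h3 (by positivity)
    have h1 : 15 * n * Real.log p / p * ((p : ℝ) - 1) ≤ tOf n p * ((p : ℝ) - 1) :=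
      mul_le_mul_of_nonneg_right ht1 hp1.le
    linarith
  have h20 : (1 / 20 : ℝ) ^ (tOf n p) ≤ Real.exp (-(41 * n * Real.log p / p)) := by
    have hlog20 : (2.77 : ℝ) ≤ Real.log 20 := by
      have h16 : Real.log 16 = 4 * Real.log 2 := by
        rw [show (16 : ℝ) = 2 ^ 4 by norm_num, Real.log_pow]; norm_num
      have := Real.log_two_gt_d9
      have hmono : Real.log 16 ≤ Real.log 20 := Real.log_le_log (by norm_num) (by norm_num)
      linarith
    have heq : (1 / 20 : ℝ) ^ (tOf n p) = Real.exp (-(tOf n p * Real.log 20)) := by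
      rw [show -(↑(tOf n p) * Real.log 20) = (tOf n p : ℝ) * Real.log (1 / 20) by
        rw [Real.log_div one_ne_zero (by norm_num), Real.log_one]; ring]
      rw [Real.exp_nat_mul, Real.exp_log (by norm_num)]
    rw [heq, Real.exp_le_exp]
    have : 41 * n * Real.log p / p ≤ tOf n p * Real.log 20 := by
      calc 41 * n * Real.log p / p ≤ (15 * n * Real.log p / p) * 2.77 := by
            rw [show 41 * n * Real.log p / p = (15 * n * Real.log p / p) * (41 / 15) by ring]
            exact mul_le_mul_of_nonneg_left (by norm_num) (by positivity)
        _ ≤ tOf n p * Real.log 20 := mul_le_mul ht1 hlog20 (by norm_num) htpos.le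
    linarith
  calc (n.choose (tOf n p) : ℝ) ≤ (Real.exp 1 * n / tOf n p) ^ (tOf n p) := hc
    _ ≤ ((1 / 20) * ((p : ℝ) - 1)) ^ (tOf n p) := pow_le_pow_left₀ (by positivity) hbase _
    _ = (1 / 20) ^ (tOf n p) * ((p : ℝ) - 1) ^ (tOf n p) := by rw [mul_pow]
    _ ≤ Real.exp (-(41 * n * Real.log p / p)) * ((p : ℝ) - 1) ^ (tOf n p) :=
        mul_le_mul_of_nonneg_right h20 (pow_nonneg hp1.le _)

/-- Regime 3, per vector: for `n/p ≤ |supp v|` the expansion-failure event has mass at most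
`(exp((n/p+2)(1+log p) - n/2) + exp(-41 n log p / p)) |Ω|`.
[Beck 2017, Lemma 5.2 (proof, expansion)] [cite: Beck2017, Lemma 5.2 (proof, expansion)] -/
theorem regime3_perVector (hp : 10 ^ 4 ≤ p) (hn3 : 3 * p ≤ n) {d' : ℕ} (hd'4 : p ^ 2 ≤ 4 * d')
    (v : Fin (n + 1) → ZMod p) (hlo : (n : ℝ) / p ≤ (vsupp v).card) :
    ((expFail (n := n) (2 * d') v ((1 - thetaOf p) * n)).card : ℝ) ≤
      (Real.exp ((n / p + 2) * (1 + Real.log p) - n / 2) + Real.exp (-(41 * n * Real.log p / p))) *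
        (Fintype.card (PickSpace (n + 1) (2 * d') n p) : ℝ) := by
  classical
  have hp2 := (Fact.out : p.Prime).two_le
  have hpR : (10 : ℝ) ^ 4 ≤ p := by exact_mod_cast hp
  have hppos : (0 : ℝ) < p := by linarith
  have hpnat : 0 < p := by omega
  have hnR : 3 * (p : ℝ) ≤ n := by exact_mod_cast hn3
  have hnpos : (0 : ℝ) < n := by linarith
  set N := (Fintype.card (PickSpace (n + 1) (2 * d') n p) : ℝ) with hN
  have hNnn : 0 ≤ N := Nat.cast_nonneg _
  -- integer bookkeeping for `W + t ≤ n - a`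
  have ha1 : (n : ℝ) / p ≤ ((n / p + 1 : ℕ) : ℝ) := by
    have h := Nat.lt_div_mul_add (a := n) hpnat
    have : (n : ℝ) < ((n / p : ℕ) : ℝ) * p + p := by exact_mod_cast h
    push_cast
    rw [div_le_iff₀ hppos]; linarith
  have ha3 : ((n / p + 1 : ℕ) : ℝ) ≤ n / p + 1 := by
    push_cast
    have := Nat.cast_div_le (α := ℝ) (m := n) (n := p)
    linarith
  have han : n / p + 1 + 1 ≤ n := by
    have h1 : n / p ≤ n / 3 := Nat.div_le_div_left (by omega) (by norm_num)
    have h0 := Nat.zero_le (n / p)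
    omega
  have ht2 : (tOf n p : ℝ) ≤ 15 * n * Real.log p / p + 1 := by
    rw [tOf]; push_cast
    have := Nat.floor_le (show (0 : ℝ) ≤ 15 * n * Real.log p / p by
      have := nine_le_log hpR; positivity)
    linarith
  have hW : (1 - thetaOf p) * n + tOf n p ≤ (n : ℝ) - ((n / p + 1 : ℕ) : ℝ) := by
    rw [thetaOf]
    have h2 : (2 + 15 * Real.log p) / p * n = 2 * (n / p) + 15 * n * Real.log p / p := by
      field_simp
    have h3 : (2 : ℝ) ≤ n / p := by rw [le_div_iff₀ hppos]; linarith
    nlinarith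
  have hmain := card_expansion_fail_le (m := n + 1) (n := n) (p := p) (d := 2 * d') (by omega) hp2 v
    (vsupp_spec v) (a := n / p + 1) (t := tOf n p) han hW
  refine hmain.trans ?_
  rw [add_mul]
  refine add_le_add ?_ ?_
  · calc (n.choose (n / p + 1 + 1) : ℝ) * N * ((((n - (n / p + 1 + 1) : ℕ) : ℝ)) / n) ^ ((vsupp v).card * (2 * d'))
        = (n.choose (n / p + 1 + 1) : ℝ) * ((((n - (n / p + 1 + 1) : ℕ) : ℝ)) / n) ^ ((vsupp v).card * (2 * d')) * N := by
          ring
      _ ≤ _ := mul_le_mul_of_nonneg_right (regime3_covTerm hp hn3 hd'4 hlo) hNnn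
  · calc (n.choose (tOf n p) : ℝ) * N / ((p : ℝ) - 1) ^ (tOf n p)
        = (n.choose (tOf n p) : ℝ) / ((p : ℝ) - 1) ^ (tOf n p) * N := by ring
      _ ≤ _ := mul_le_mul_of_nonneg_right (regime3_zeroTerm hp (by omega)) hNnn

/-- The coefficient vectors of the expansion range `n/p ≤ |supp v| ≤ 3n/p`.
[Bonacina 2017, Prop. 8.1(3)] [folklore] -/
noncomputable def vecsRange3 (n : ℕ) (p : ℕ) [Fact p.Prime] : Finset (Fin (n + 1) → ZMod p) :=
  univ.filter fun v => (n : ℝ) / p ≤ (vsupp v).card ∧ ((vsupp v).card : ℝ) ≤ 3 * n / p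

/-- Membership in `vecsRange3`. [folklore] -/
theorem mem_vecsRange3 {v : Fin (n + 1) → ZMod p} :
    v ∈ vecsRange3 n p ↔ (n : ℝ) / p ≤ (vsupp v).card ∧ ((vsupp v).card : ℝ) ≤ 3 * n / p := by
  simp only [vecsRange3, Finset.mem_filter, Finset.mem_univ, true_and]

/-- Regime 3, the number of vectors: at most `(4n/p) exp(9 n log p / p)`. [folklore] -/
theorem regime3_cardV (hp : 10 ^ 4 ≤ p) (hnp : p ≤ n) :
    ((vecsRange3 n p).card : ℝ) ≤ 4 * (n / p) * Real.exp (9 * n * Real.log p / p) := by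
  classical
  have hp2 := (Fact.out : p.Prime).two_le
  have hpR : (10 : ℝ) ^ 4 ≤ p := by exact_mod_cast hp
  have hppos : (0 : ℝ) < p := by linarith
  have hpnat : 0 < p := by omega
  have hnR : (p : ℝ) ≤ n := by exact_mod_cast hnp
  have hnpos : (0 : ℝ) < n := by linarith
  have hlogp9 : 9 ≤ Real.log p := nine_le_log hpR
  set R := 3 * n / p with hR
  set s₁ := ⌈(n : ℝ) / p⌉₊ with hs₁
  have hRle : (R : ℝ) ≤ 3 * n / p := by
    have := Nat.cast_div_le (α := ℝ) (m := 3 * n) (n := p); push_cast at this; exact this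
  have hs₁ge : (n : ℝ) / p ≤ s₁ := Nat.le_ceil _
  have hsub : vecsRange3 n p ⊆ (Finset.Icc s₁ R).biUnion fun s => vecsOfCard (n + 1) p s := by
    intro v hv
    obtain ⟨h1, h2⟩ := mem_vecsRange3.1 hv
    rw [Finset.mem_biUnion]
    refine ⟨(vsupp v).card, Finset.mem_Icc.2 ⟨?_, ?_⟩, mem_vecsOfCard.2 rfl⟩
    · exact Nat.ceil_le.2 h1
    · rw [hR, Nat.le_div_iff_mul_le hpnat]
      have : ((vsupp v).card : ℝ) * p ≤ 3 * n := by rwa [le_div_iff₀ hppos] at h2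
      exact_mod_cast this
  have hper : ∀ s ∈ Finset.Icc s₁ R, ((vecsOfCard (n + 1) p s).card : ℝ) ≤ (2 * Real.exp 1 * p * p) ^ R := by
    intro s hs
    obtain ⟨hs1, hs2⟩ := Finset.mem_Icc.1 hs
    have hsR : (n : ℝ) / p ≤ s := le_trans hs₁ge (by exact_mod_cast hs1)
    have hs0R : (1 : ℝ) ≤ s := le_trans (by rw [le_div_iff₀ hppos]; linarith) hsR
    have hs0 : 1 ≤ s := by exact_mod_cast hs0R
    have hspos : (0 : ℝ) < s := by linarith
    have hp0 : (0 : ℝ) ≤ (p : ℝ) - 1 := by linarith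
    have hbase1 : 1 ≤ 2 * Real.exp 1 * p * p := by
      have h2e : (2 : ℝ) ≤ Real.exp 1 := by linarith [Real.add_one_le_exp (1:ℝ)]
      have hp1 : (1 : ℝ) ≤ p := by linarith
      calc (1 : ℝ) ≤ 2 * 2 * 1 * 1 := by norm_num
        _ ≤ 2 * Real.exp 1 * p * p := by gcongr
    calc ((vecsOfCard (n + 1) p s).card : ℝ) ≤ ((n + 1).choose s : ℝ) * ((p : ℝ) - 1) ^ s :=
          card_vsupp_card_eq_le (m := n + 1) s
      _ ≤ (Real.exp 1 * (n + 1 : ℕ) / s) ^ s * ((p : ℝ) - 1) ^ s :=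
          mul_le_mul_of_nonneg_right (choose_le_epow _ hs0) (pow_nonneg hp0 s)
      _ = (Real.exp 1 * (n + 1 : ℕ) / s * ((p : ℝ) - 1)) ^ s := by rw [mul_pow]
      _ ≤ (2 * Real.exp 1 * p * p) ^ s := by
          apply pow_le_pow_left₀ (mul_nonneg (by positivity) hp0)
          have h1 : Real.exp 1 * (n + 1 : ℕ) / s ≤ 2 * Real.exp 1 * p := by
            rw [div_le_iff₀ hspos]
            have : ((n + 1 : ℕ) : ℝ) ≤ 2 * p * s := by
              push_cast
              have : (n : ℝ) ≤ p * s := by rw [div_le_iff₀ hppos] at hsR; linarith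
              nlinarith
            nlinarith [Real.exp_pos 1]
          calc Real.exp 1 * (n + 1 : ℕ) / s * ((p : ℝ) - 1) ≤ (2 * Real.exp 1 * p) * p :=
                mul_le_mul h1 (by linarith) hp0 (by positivity)
            _ = 2 * Real.exp 1 * p * p := by ring
      _ ≤ (2 * Real.exp 1 * p * p) ^ R := pow_le_pow_right₀ hbase1 hs2
  calc ((vecsRange3 n p).card : ℝ)
      ≤ (((Finset.Icc s₁ R).biUnion fun s => vecsOfCard (n + 1) p s).card : ℝ) := by
        exact_mod_cast Finset.card_le_card hsub
    _ ≤ ∑ s ∈ Finset.Icc s₁ R, ((vecsOfCard (n + 1) p s).card : ℝ) := by exact_mod_cast Finset.card_biUnion_le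
    _ ≤ ∑ s ∈ Finset.Icc s₁ R, (2 * Real.exp 1 * p * p) ^ R := Finset.sum_le_sum hper
    _ = ((Finset.Icc s₁ R).card : ℝ) * (2 * Real.exp 1 * p * p) ^ R := by rw [Finset.sum_const, nsmul_eq_mul]
    _ ≤ (4 * (n / p)) * Real.exp (9 * n * Real.log p / p) := by
        apply mul_le_mul _ _ (by positivity) (by positivity)
        · have hcard : ((Finset.Icc s₁ R).card : ℝ) ≤ R + 1 := by
            have h0 := Nat.zero_le R
            have h1 := Nat.zero_le s₁
            have h : (Finset.Icc s₁ R).card ≤ R + 1 := by rw [Nat.card_Icc]; omega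
            exact_mod_cast h
          have hnp1 : (1 : ℝ) ≤ n / p := by rw [le_div_iff₀ hppos]; linarith
          calc ((Finset.Icc s₁ R).card : ℝ) ≤ R + 1 := hcard
            _ ≤ 3 * n / p + 1 := by linarith
            _ = 3 * (n / p) + 1 := by ring
            _ ≤ 4 * (n / p) := by linarith
        · have hXpos : (0 : ℝ) < 2 * Real.exp 1 * p * p := by positivity
          have hX1 : (1 : ℝ) ≤ 2 * Real.exp 1 * p * p := by
            have h2e : (2 : ℝ) ≤ Real.exp 1 := by linarith [Real.add_one_le_exp (1:ℝ)]
            have hp1 : (1 : ℝ) ≤ p := by linarith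
            calc (1 : ℝ) ≤ 2 * 2 * 1 * 1 := by norm_num
              _ ≤ 2 * Real.exp 1 * p * p := by gcongr
          rw [← Real.exp_log (pow_pos hXpos R), Real.exp_le_exp, Real.log_pow]
          have hlogX : Real.log (2 * Real.exp 1 * p * p) ≤ 3 * Real.log p := by
            rw [show 2 * Real.exp 1 * p * p = (2 * Real.exp 1) * ((p : ℝ) * p) by ring,
              Real.log_mul (by positivity) (by positivity), Real.log_mul hppos.ne' hppos.ne']
            have : Real.log (2 * Real.exp 1) ≤ Real.log p := by
              apply Real.log_le_log (by positivity)
              nlinarith [exp_one_le_three]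
            linarith
          calc (R : ℝ) * Real.log (2 * Real.exp 1 * p * p) ≤ (3 * n / p) * (3 * Real.log p) :=
                mul_le_mul hRle hlogX (Real.log_nonneg hX1) (by positivity)
            _ = 9 * n * Real.log p / p := by ring

omit [Fact p.Prime] in
/-- Regime 3, numerics. [folklore] -/
theorem regime3_numeric (hp : 10 ^ 4 ≤ p) (hnp : p ≤ n) (hn : 100 ≤ n) :
    4 * ((n : ℝ) / p) * Real.exp (9 * n * Real.log p / p) *
        (Real.exp ((n / p + 2) * (1 + Real.log p) - n / 2) + Real.exp (-(41 * n * Real.log p / p))) ≤ 1 / 8 := by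
  have hpR : (10 : ℝ) ^ 4 ≤ p := by exact_mod_cast hp
  have hppos : (0 : ℝ) < p := by linarith
  have hnR : (p : ℝ) ≤ n := by exact_mod_cast hnp
  have hn100 : (100 : ℝ) ≤ n := by exact_mod_cast hn
  have hnpos : (0 : ℝ) < n := by linarith
  have hlogp : Real.log p ≤ p / 480 := log_le_div_480 hpR
  have hlogp9 : 9 ≤ Real.log p := nine_le_log hpR
  set u : ℝ := n / p with hu
  have hu1 : 1 ≤ u := by rw [hu, le_div_iff₀ hppos]; linarith
  have hun : u * p = n := by rw [hu]; field_simp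
  rw [mul_add]
  have hA : 4 * u * Real.exp (9 * n * Real.log p / p) * Real.exp ((n / p + 2) * (1 + Real.log p) - n / 2) ≤ 1 / 16 := by
    -- exponent `≤ -0.47 n`, and `4u ≤ 4n ≤ 160 exp(n/40 - 1)`
    have hexp : 9 * n * Real.log p / p + ((n / p + 2) * (1 + Real.log p) - n / 2) ≤ -(47 * n / 100) := by
      rw [show 9 * n * Real.log p / p = 9 * u * Real.log p by rw [hu]; field_simp, show (n : ℝ) / p = u from rfl]
      have h1 : 10 * Real.log p + 1 ≤ p / 40 := by linarith
      have h2 : 2 + 2 * Real.log p ≤ u * p / 200 := by nlinarith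
      have h3 : (n : ℝ) = u * p := hun.symm
      rw [h3]
      nlinarith
    have h4u : 4 * u ≤ 160 * Real.exp (n / 40 - 1) := by
      have h1 : u ≤ n := by rw [hu, div_le_iff₀ hppos]; nlinarith
      have h2 : (n : ℝ) / 40 ≤ Real.exp (n / 40 - 1) := le_exp_sub_one _
      linarith
    calc 4 * u * Real.exp (9 * n * Real.log p / p) * Real.exp ((n / p + 2) * (1 + Real.log p) - n / 2)
        = 4 * u * Real.exp (9 * n * Real.log p / p + ((n / p + 2) * (1 + Real.log p) - n / 2)) := by
          rw [Real.exp_add]; ring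
      _ ≤ 160 * Real.exp (n / 40 - 1) * Real.exp (-(47 * n / 100)) := by
          apply mul_le_mul h4u (Real.exp_le_exp.2 hexp) (Real.exp_pos _).le (by positivity)
      _ = 160 * Real.exp (n / 40 - 1 + -(47 * n / 100)) := by rw [mul_assoc, ← Real.exp_add]
      _ ≤ 160 * Real.exp (-9) := by gcongr; linarith
      _ ≤ 1 / 16 := by
          rw [Real.exp_neg, mul_inv_le_iff₀ (Real.exp_pos 9)]; linarith [exp_nine_ge]
  have hB : 4 * u * Real.exp (9 * n * Real.log p / p) * Real.exp (-(41 * n * Real.log p / p)) ≤ 1 / 16 := by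
    have hexp : 9 * n * Real.log p / p + -(41 * n * Real.log p / p) ≤ -(8 + u) := by
      rw [show 9 * n * Real.log p / p + -(41 * n * Real.log p / p) = -(32 * u * Real.log p) by rw [hu]; field_simp; ring]
      nlinarith
    have h4u : 4 * u ≤ 4 * Real.exp (u - 1) := by linarith [le_exp_sub_one u]
    calc 4 * u * Real.exp (9 * n * Real.log p / p) * Real.exp (-(41 * n * Real.log p / p))
        = 4 * u * Real.exp (9 * n * Real.log p / p + -(41 * n * Real.log p / p)) := by rw [Real.exp_add]; ring
      _ ≤ 4 * Real.exp (u - 1) * Real.exp (-(8 + u)) :=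
          mul_le_mul h4u (Real.exp_le_exp.2 hexp) (Real.exp_pos _).le (by positivity)
      _ = 4 * Real.exp (u - 1 + -(8 + u)) := by rw [mul_assoc, ← Real.exp_add]
      _ = 4 * Real.exp (-9) := by ring_nf
      _ ≤ 1 / 16 := by
          rw [Real.exp_neg, mul_inv_le_iff₀ (Real.exp_pos 9)]; linarith [exp_nine_ge]
  have hu' : 4 * ((n : ℝ) / p) = 4 * u := by rw [hu]
  rw [hu'] at *
  linarith

/-- **Regime 3** (Beck 2017, Lemma 5.2, the expansion range): the total mass of the
expansion-failure events `|supp(Σ v_i row_i)| < (1-θ)n` over all `v` with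
`n/p ≤ |supp v| ≤ 3n/p` is at most `|Ω|/8` (`p ≥ 10⁴`, `4d' ≥ p²`, `n ≥ 3p`, `n ≥ 100`).
[cite: Beck2017, Lemma 5.2 (proof, expansion)] -/
theorem regime3_bound (hp : 10 ^ 4 ≤ p) (hn : 100 ≤ n) (hn3 : 3 * p ≤ n) {d' : ℕ} (hd'4 : p ^ 2 ≤ 4 * d') :
    ∑ v ∈ vecsRange3 n p, ((expFail (n := n) (2 * d') v ((1 - thetaOf p) * n)).card : ℝ) ≤
      (Fintype.card (PickSpace (n + 1) (2 * d') n p) : ℝ) / 8 := by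
  set N := (Fintype.card (PickSpace (n + 1) (2 * d') n p) : ℝ) with hN
  have hNnn : 0 ≤ N := Nat.cast_nonneg _
  set Q : ℝ := Real.exp ((n / p + 2) * (1 + Real.log p) - n / 2) + Real.exp (-(41 * n * Real.log p / p)) with hQ
  calc ∑ v ∈ vecsRange3 n p, ((expFail (n := n) (2 * d') v ((1 - thetaOf p) * n)).card : ℝ)
      ≤ ∑ v ∈ vecsRange3 n p, Q * N :=
        Finset.sum_le_sum fun v hv => regime3_perVector hp hn3 hd'4 v (mem_vecsRange3.1 hv).1
    _ = ((vecsRange3 n p).card : ℝ) * Q * N := by rw [Finset.sum_const, nsmul_eq_mul]; ring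
    _ ≤ (4 * (n / p) * Real.exp (9 * n * Real.log p / p)) * Q * N := by
        apply mul_le_mul_of_nonneg_right _ hNnn
        exact mul_le_mul_of_nonneg_right (regime3_cardV hp (by omega)) (by positivity)
    _ ≤ 1 / 8 * N := mul_le_mul_of_nonneg_right (regime3_numeric hp (by omega) hn) hNnn
    _ = N / 8 := by ring

end Regime3

end Literature.Computability.MetaComplexity

namespace Literature.Computability.MetaComplexity

open Finset Real Filter

section Existence

variable {n p : ℕ} [Fact p.Prime]

/-- The support of a non-zero vector is non-empty. [folklore] -/
theorem vsupp_card_pos {m : ℕ} {v : Fin m → ZMod p} (hv : v ≠ 0) : 1 ≤ (vsupp v).card := by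
  rw [Nat.one_le_iff_ne_zero, Ne, Finset.card_eq_zero]
  intro h
  apply hv
  funext i
  by_contra hi
  have : i ∈ vsupp v := Finset.mem_filter.2 ⟨Finset.mem_univ _, hi⟩
  rw [h] at this
  simp at this

/-- **A good sample exists** (Beck 2017, Lemma 5.2; Bonacina 2017, Prop. 8.1, the probabilistic
construction made a finite count): for a prime `p ≥ 10⁴`, `n ≥ 100`, `n ≥ 3p` and
`d' = ⌊(p²-1)/2⌋`, some sample `ω` of `n+1` rows of `2d' ≤ p²` picks each has (i) no non-zero
`v` with `|supp v| ≤ 3n/p` and `Σ v_i row_i = 0`, and (ii) `|supp(Σ v_i row_i)| ≥ (1-θ(p))n`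
whenever `n/p ≤ |supp v| ≤ 3n/p` — the bad samples have mass `≤ (1/7 + 1/8 + 1/8)|Ω| < |Ω|`
(`regime1_bound`, `regime2_bound`, `regime3_bound`).
[cite: Beck2017, Lemma 5.2; Bonacina2017, Prop. 8.1] -/
theorem exists_goodSample (hp : 10 ^ 4 ≤ p) (hn100 : 100 ≤ n) (hn3 : 3 * p ≤ n) :
    ∃ ω : PickSpace (n + 1) (2 * ((p ^ 2 - 1) / 2)) n p,
      (∀ v : Fin (n + 1) → ZMod p, v ≠ 0 → ((vsupp v).card : ℝ) ≤ 3 * n / p → ∃ j, combVec ω v j ≠ 0) ∧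
      (∀ v : Fin (n + 1) → ZMod p, (n : ℝ) / p ≤ (vsupp v).card → ((vsupp v).card : ℝ) ≤ 3 * n / p →
        (1 - thetaOf p) * n ≤ ((univ.filter fun j => combVec ω v j ≠ 0).card : ℝ)) := by
  classical
  set d' := (p ^ 2 - 1) / 2 with hd'
  have hp2 := (Fact.out : p.Prime).two_le
  have hpnat : 0 < p := by omega
  have hpR : (10 : ℝ) ^ 4 ≤ p := by exact_mod_cast hp
  have hppos : (0 : ℝ) < p := by linarith
  -- facts about `d'`
  have hp2sq : p ^ 2 = p * p := by ring
  have hd'2 : 2 * d' ≤ p ^ 2 := by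
    have := Nat.mul_div_le (p ^ 2 - 1) 2; omega
  have hd'4 : p ^ 2 ≤ 4 * d' := by
    have := Nat.lt_div_mul_add (a := p ^ 2 - 1) (show 0 < 2 by norm_num)
    have : 10 ^ 4 * 10 ^ 4 ≤ p * p := Nat.mul_le_mul hp hp
    omega
  have hd'1 : 1 ≤ d' := by nlinarith
  have hd'3 : 3 * p + 8 ≤ d' := by
    rw [hd', Nat.le_div_iff_mul_le (by norm_num)]
    have : 10 ^ 4 * p ≤ p * p := Nat.mul_le_mul_right p hp
    omega
  have hd'p2 : d' ≤ p ^ 2 := by omega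
  set N := (Fintype.card (PickSpace (n + 1) (2 * d') n p) : ℝ) with hN
  set R := 3 * n / p with hR
  set W : ℝ := (1 - thetaOf p) * n with hW
  -- the bad sets
  let B₂ : Finset (PickSpace (n + 1) (2 * d') n p) := univ.filter fun ω =>
    ∃ v : Fin (n + 1) → ZMod p, v ≠ 0 ∧ ((vsupp v).card : ℝ) ≤ 3 * n / p ∧ ∀ j, combVec ω v j = 0
  let B₃ : Finset (PickSpace (n + 1) (2 * d') n p) := univ.filter fun ω =>
    ∃ v : Fin (n + 1) → ZMod p, (n : ℝ) / p ≤ (vsupp v).card ∧ ((vsupp v).card : ℝ) ≤ 3 * n / p ∧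
      ((univ.filter fun j => combVec ω v j ≠ 0).card : ℝ) < W
  -- `|B₂| ≤ N/7 + N/8`
  have hR_of_le : ∀ v : Fin (n + 1) → ZMod p, ((vsupp v).card : ℝ) ≤ 3 * n / p → (vsupp v).card ≤ R := by
    intro v hv
    rw [hR, Nat.le_div_iff_mul_le hpnat]
    have : ((vsupp v).card : ℝ) * p ≤ 3 * n := by rwa [le_div_iff₀ hppos] at hv
    exact_mod_cast this
  have hB₂sub : B₂ ⊆ (Finset.Icc 1 R).biUnion fun s => (vecsOfCard (n + 1) p s).biUnion fun v =>
      kernelEvent (2 * d') n v := by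
    intro ω hω
    obtain ⟨-, v, hv0, hvle, hker⟩ := Finset.mem_filter.1 hω
    rw [Finset.mem_biUnion]
    refine ⟨(vsupp v).card, Finset.mem_Icc.2 ⟨vsupp_card_pos hv0, hR_of_le v hvle⟩, ?_⟩
    rw [Finset.mem_biUnion]
    exact ⟨v, mem_vecsOfCard.2 rfl, mem_kernelEvent.2 hker⟩
  have hB₂ : (B₂.card : ℝ) ≤ N / 7 + N / 8 := by
    have hnn : ∀ s, 0 ≤ ∑ v ∈ vecsOfCard (n + 1) p s, ((kernelEvent (2 * d') n v).card : ℝ) :=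
      fun s => Finset.sum_nonneg fun v _ => Nat.cast_nonneg _
    calc (B₂.card : ℝ)
        ≤ (((Finset.Icc 1 R).biUnion fun s => (vecsOfCard (n + 1) p s).biUnion fun v =>
            kernelEvent (2 * d') n v).card : ℝ) := by exact_mod_cast Finset.card_le_card hB₂sub
      _ ≤ ∑ s ∈ Finset.Icc 1 R, (((vecsOfCard (n + 1) p s).biUnion fun v => kernelEvent (2 * d') n v).card : ℝ) := by
          exact_mod_cast Finset.card_biUnion_le
      _ ≤ ∑ s ∈ Finset.Icc 1 R, ∑ v ∈ vecsOfCard (n + 1) p s, ((kernelEvent (2 * d') n v).card : ℝ) := by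
          refine Finset.sum_le_sum fun s _ => ?_
          exact_mod_cast Finset.card_biUnion_le
      _ ≤ ∑ s ∈ Finset.Icc 1 (n / (8 * d')) ∪ Finset.Icc (n / (8 * d') + 1) R,
            ∑ v ∈ vecsOfCard (n + 1) p s, ((kernelEvent (2 * d') n v).card : ℝ) := by
          apply Finset.sum_le_sum_of_subset_of_nonneg
          · intro s hs
            rw [Finset.mem_union, Finset.mem_Icc, Finset.mem_Icc]
            have := Finset.mem_Icc.1 hs
            omega
          · intro s _ _; exact hnn s
      _ ≤ ∑ s ∈ Finset.Icc 1 (n / (8 * d')), ∑ v ∈ vecsOfCard (n + 1) p s, ((kernelEvent (2 * d') n v).card : ℝ) +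
            ∑ s ∈ Finset.Icc (n / (8 * d') + 1) R, ∑ v ∈ vecsOfCard (n + 1) p s, ((kernelEvent (2 * d') n v).card : ℝ) := by
          rw [Finset.sum_union]
          rw [Finset.disjoint_left]
          intro s h1 h2
          rw [Finset.mem_Icc] at h1 h2
          omega
      _ ≤ N / 7 + N / 8 := add_le_add (regime1_bound (by omega) hd'3 hd'p2) (regime2_bound hn100 hp hd'1 hd'2)
  -- `|B₃| ≤ N/8`
  have hB₃sub : B₃ ⊆ (vecsRange3 n p).biUnion fun v => expFail (n := n) (2 * d') v W := by
    intro ω hω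
    obtain ⟨-, v, h1, h2, h3⟩ := Finset.mem_filter.1 hω
    exact Finset.mem_biUnion.2 ⟨v, mem_vecsRange3.2 ⟨h1, h2⟩, mem_expFail.2 h3⟩
  have hB₃ : (B₃.card : ℝ) ≤ N / 8 := by
    calc (B₃.card : ℝ) ≤ (((vecsRange3 n p).biUnion fun v => expFail (n := n) (2 * d') v W).card : ℝ) := by
          exact_mod_cast Finset.card_le_card hB₃sub
      _ ≤ ∑ v ∈ vecsRange3 n p, ((expFail (n := n) (2 * d') v W).card : ℝ) := by exact_mod_cast Finset.card_biUnion_le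
      _ ≤ N / 8 := regime3_bound hp hn100 hn3 hd'4
  -- hence a sample outside both bad sets
  have hlt : ((B₂ ∪ B₃).card : ℝ) < N := by
    have hNpos : 0 < N := by
      haveI : Nonempty (PickSpace (n + 1) (2 * d') n p) := ⟨fun _ => (⟨0, by omega⟩, 1)⟩
      rw [hN]; exact_mod_cast Fintype.card_pos
    calc ((B₂ ∪ B₃).card : ℝ) ≤ (B₂.card : ℝ) + B₃.card := by exact_mod_cast Finset.card_union_le _ _
      _ ≤ N / 7 + N / 8 + N / 8 := by linarith
      _ < N := by linarith
  have hne : B₂ ∪ B₃ ≠ univ := by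
    intro h
    rw [h, Finset.card_univ] at hlt
    exact lt_irrefl _ hlt
  obtain ⟨ω, -, hω⟩ : ∃ ω ∈ (univ : Finset (PickSpace (n + 1) (2 * d') n p)), ω ∉ B₂ ∪ B₃ := by
    by_contra h
    push Not at h
    exact hne (Finset.eq_univ_of_forall fun ω => h ω (Finset.mem_univ ω))
  rw [Finset.mem_union, not_or] at hω
  refine ⟨ω, fun v hv0 hvle => ?_, fun v h1 h2 => ?_⟩
  · by_contra hall
    push Not at hall
    exact hω.1 (Finset.mem_filter.2 ⟨Finset.mem_univ _, v, hv0, hvle, hall⟩)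
  · by_contra hlt'
    push Not at hlt'
    exact hω.2 (Finset.mem_filter.2 ⟨Finset.mem_univ _, v, h1, h2, hlt'⟩)

end Existence

/-! ### The discharge -/

/-- **Discharge of `fpExpandingSystem`** (Bonacina 2017, Prop. 8.1 = Beck–Impagliazzo 2013,
Lemma 4.2; proved here by a finite count instead of the printed probabilistic sketch of Beck
2017, Lemma 5.2): with `C = 17`, `c = 1`, every prime `p ≥ 10⁴` admits `δ = 1/p`,
`θ = (2 + 15 log p)/p`, and for `n ≥ max(100, 3p)` the rows of a good sample (`exists_goodSample`)
with a right-hand side outside the image of the coefficient matrix form the required system: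
supports `≤ p² - 1`, unsatisfiable, every sub-system of `≤ 3n/p` equations satisfiable (a dual
witness of an unsatisfiable sub-system would be a short vanishing combination,
`exists_dual_witness`), and every combination with `n/p ≤ |supp v| ≤ 3n/p` supported on
`≥ (1-θ)n` variables. [cite: Bonacina2017, Prop. 8.1; Beck2017, Lemma 5.2] -/
theorem fpExpandingSystem_holds : fpExpandingSystem := by
  classical
  refine ⟨17, 1, Filter.eventually_atTop.2 ⟨10 ^ 4, fun p hp hprime => ?_⟩⟩
  haveI : Fact p.Prime := ⟨hprime⟩
  have hpR : (10 : ℝ) ^ 4 ≤ p := by exact_mod_cast hp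
  have hppos : (0 : ℝ) < p := by linarith
  have hpnat : 0 < p := hprime.pos
  have hlog9 : 9 ≤ Real.log p := nine_le_log hpR
  refine ⟨1 / p, thetaOf p, by positivity, ?_, ?_, ?_, ?_⟩
  · rw [div_le_div_iff₀ hppos hppos]; nlinarith
  · rw [thetaOf]; positivity
  · rw [thetaOf, pow_one, div_le_div_iff₀ hppos hppos]; nlinarith
  refine Filter.eventually_atTop.2 ⟨max 100 (3 * p), fun n hn => ?_⟩
  have hn100 : 100 ≤ n := le_trans (le_max_left _ _) hn
  have hn3 : 3 * p ≤ n := le_trans (le_max_right _ _) hn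
  obtain ⟨ω, hω1, hω2⟩ := exists_goodSample hp hn100 hn3
  -- the right-hand side outside the image
  let f : (Fin n → ZMod p) → (Fin (n + 1) → ZMod p) := fun z i => ∑ j, rowVec ω i j * z j
  have hnot : ¬ Function.Surjective f := by
    intro hs
    have := Fintype.card_le_of_surjective f hs
    rw [Fintype.card_fun, Fintype.card_fun, ZMod.card, Fintype.card_fin, Fintype.card_fin] at this
    have h2 : p ^ n < p ^ (n + 1) := Nat.pow_lt_pow_right (by omega) (Nat.lt_succ_self n)
    omega
  obtain ⟨b, hb⟩ : ∃ b, ∀ z, f z ≠ b := by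
    by_contra h
    push Not at h
    exact hnot fun b => h b
  let E : Fin (n + 1) → LinEqMod p n := fun i => (rowVec ω i, b i)
  refine ⟨E, fun i => ?_, ?_, fun S hS => ?_, fun v hv1 hv2 => ?_⟩
  · -- supports
    have h := rowVec_supp_card_le ω i
    have h2 : ((2 * ((p ^ 2 - 1) / 2) : ℕ) : ℝ) ≤ (p : ℝ) ^ 2 := by
      have : 2 * ((p ^ 2 - 1) / 2) ≤ p ^ 2 := by have := Nat.mul_div_le (p ^ 2 - 1) 2; omega
      exact_mod_cast this
    calc (((E i).supp.card : ℕ) : ℝ) ≤ ((2 * ((p ^ 2 - 1) / 2) : ℕ) : ℝ) := by exact_mod_cast h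
      _ ≤ (p : ℝ) ^ 2 := h2
  · -- unsatisfiable
    rintro ⟨z, hz⟩
    exact hb z (funext fun i => hz i (Finset.mem_univ i))
  · -- small sub-systems are satisfiable
    by_contra hS'
    have hno : ¬ ∃ z : Fin n → ZMod p, ∀ k : S, ∑ i, (fun (k : S) (i : Fin n) => rowVec ω k i) k i * z i = b k := by
      rintro ⟨z, hz⟩
      exact hS' ⟨z, fun i hi => hz ⟨i, hi⟩⟩
    obtain ⟨lam, hlam1, hlam2⟩ := exists_dual_witness (fun (k : S) (i : Fin n) => rowVec ω k i) (fun k : S => b k) hno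
    let v : Fin (n + 1) → ZMod p := fun i => if h : i ∈ S then lam ⟨i, h⟩ else 0
    have hvS : vsupp v ⊆ S := fun i hi => by
      by_contra h
      have := (Finset.mem_filter.1 hi).2
      simp [v, h] at this
    have hv0 : v ≠ 0 := by
      intro h0
      apply hlam2
      have : ∀ k : S, lam k = 0 := fun k => by
        have := congrFun h0 k
        simpa [v, k.2] using this
      simp [this]
    have hvle : ((vsupp v).card : ℝ) ≤ 3 * n / p := by
      calc ((vsupp v).card : ℝ) ≤ S.card := by exact_mod_cast Finset.card_le_card hvS
        _ ≤ 3 * (1 / p) * n := hS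
        _ = 3 * n / p := by ring
    obtain ⟨j, hj⟩ := hω1 v hv0 hvle
    apply hj
    rw [combVec]
    calc ∑ i, v i * rowVec ω i j = ∑ i ∈ S, v i * rowVec ω i j :=
          (Finset.sum_subset (Finset.subset_univ S) fun i _ hi => by simp [v, hi]).symm
      _ = ∑ k : S, lam k * rowVec ω k j := by
          rw [← Finset.sum_coe_sort S]
          exact Finset.sum_congr rfl fun k _ => by simp [v, k.2]
      _ = 0 := hlam1 j
  · -- expansion
    have hsupp : (lincomb v E).supp = univ.filter fun j => combVec ω v j ≠ 0 := by
      ext j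
      simp only [LinEqMod.supp, lincomb, combVec, Finset.mem_filter, Finset.mem_univ, true_and, E]
    rw [hsupp]
    exact hω2 v (by rwa [show (1 : ℝ) / p * n = n / p by ring] at hv1)
      (by rwa [show 3 * (1 / (p : ℝ)) * n = 3 * n / p by ring] at hv2)

end Literature.Computability.MetaComplexity
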